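import Literature.Probability.RandomPlanarGeometry.DrivingIncrementAC
import Literature.Probability.RandomPlanarGeometry.RadialBesselContraction
import Mathlib.Analysis.Calculus.MeanValue
import Mathlib.Analysis.Calculus.Deriv.Pow
import HarnessLib

/-!
# The Schramm–Wilson clock: radial SLE_κ read in the half-plane is a time change of chordal SLE_κ(κ − 6) — martingale-problem form

Topic `Probability/RandomPlanarGeometry`; definitions with bodies and proved theorems only (no
named fact). This is the probabilistic heart of the Schramm–Wilson coordinate change
(Schramm–Wilson (2005), §4, Thm. 3) in the form needed to prove that radial SLE_κ is generated by
a curve via the chordal Rohde–Schramm theorem: the deterministic half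
(`RadialChordalConjugation`) writes the radial Loewner chain of `V = √κ B`, through the Cayley-type
map, as the chordal chain of the explicit driving function `W̌ = R + 𝒴 cot(Y/2)` in the half-plane
capacity clock `τ = ∫ 𝒴²/(4 sin⁴(Y/2))`, where `Y` is the radial Bessel flow of the marked boundary
point; here we show that **`W̌` is a continuous martingale with quadratic variation `κ τ`** under
any measure `Q` for which `Y` solves the SLE_κ(κ − 6) angle martingale problem (the exponential
tilt `exists_tilted_measure_target` of the radial SLE_κ law), in the packaged form
`HasMartingaleClock` consumed by the tree's Lévy characterisation / Brownian concatenation.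

* `SchrammWilson.hasMartingaleClock_swMart` — for a continuous progressive process `X` with values
  in a band `[a, 2π − a]` solving the `(κ, κ − 6)` angle martingale problem up to the horizon `T`
  for test functions supported in `(ε, 2π − ε)`, the normalised increment
  `(W − W₀)^S / √(κ Q₀²)` of `W = R + 𝒴 cot(X/2)` (`wProc`, with `𝒴 = yProc`, `R = rProc`), stopped
  at the exit `S` of `X` from `[2ε, 2π − 2ε]` (`bandExit`), has the `1`-Lipschitz martingale clock
  `τ^{S∧T}/Q₀²` (`swClock`, `τ = clockProc`), `Q₀ = 1/(2 sin²(a/2))`.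

Proof (Karatzas–Shreve, Ch. 5 §4.B, for the functional calculus of the martingale problem): with
the test functions `f = cot(·/2)·(bump)` and `f²`, integration by parts of the two martingales of
the martingale problem against the `C¹` processes `𝒴`, `2R𝒴`, `𝒴²`
(`martingale_mul_timeIntegral_sub`), the pathwise identities `identity_one` / `identity_two`
(proved by differentiation), the cancellation **`p − q cot(·/2) + L_{κ−6} cot(·/2) = 0`**
(`drift_eq_zero`; the identity `c'' + c c' = 0` for `c = cot(·/2)`) and `(cot(·/2)')² = q²`
(the clock rate), and optional stopping at `S`.

## References

* O. Schramm, D. B. Wilson, *SLE coordinate changes*, New York J. Math. 11 (2005), 659–669, §4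
  Thm. 3. [SchrammWilson2005]
* I. Karatzas, S. Shreve, *Brownian Motion and Stochastic Calculus* (1988), Ch. 5 §4.B
  (Prop. 4.6, Problem 4.13). [KaratzasShreve1988]
* G. F. Lawler, *Conformally Invariant Processes in the Plane*, AMS (2005), §4.6.3, §6.5.
  [Lawler2005]
-/

noncomputable section

open MeasureTheory Filter Set Function Metric intervalIntegral
open scoped NNReal ENNReal Topology Real

namespace Literature.Probability.RandomPlanarGeometry

namespace SchrammWilson

open Literature.Probability.Process Literature.Analysis.FunctionSpaces


variable {φ ℓ q p d : ℝ → ℝ} {y : ℝ → ℝ} {κ : ℝ}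

/-- A function with zero derivative everywhere and vanishing at `0` vanishes. [folklore] -/
theorem eq_zero_of_hasDerivAt_zero {F : ℝ → ℝ} (hF : ∀ r, HasDerivAt F 0 r) (h0 : F 0 = 0) (r : ℝ) :
    F r = 0 := by
  have h := is_const_of_deriv_eq_zero (fun r ↦ (hF r).differentiableAt) (fun r ↦ (hF r).deriv) r 0
  rw [h, h0]

/-- Primitive of a continuous function: derivative. [folklore] -/
theorem hasDerivAt_primitive {g : ℝ → ℝ} (hg : Continuous g) (r : ℝ) :
    HasDerivAt (fun r ↦ ∫ u in (0 : ℝ)..r, g u) (g r) r :=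
  (hg.integral_hasStrictDerivAt 0 r).hasDerivAt

/-- Primitive of a continuous function: continuity. [folklore] -/
theorem continuous_primitive' {g : ℝ → ℝ} (hg : Continuous g) : Continuous fun r ↦ ∫ u in (0 : ℝ)..r, g u :=
  continuous_iff_continuousAt.2 fun u ↦ (hasDerivAt_primitive hg u).continuousAt

/-- **First pathwise identity of the Schramm–Wilson clock** (smooth part). With `I = ∫ ℓ`,
`R = ∫ y p`, `ẏ = -q y`, `y₀ = 1`:
`R_r + y_r (φ₀ + I_r) - φ₀ = ∫₀ʳ (φ - φ₀ - I) q y + ∫₀ʳ y (p - q φ + ℓ)`. [folklore] -/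
theorem smooth_identity_one (hφ : Continuous φ) (hℓ : Continuous ℓ) (hq : Continuous q) (hp : Continuous p)
    (hyc : Continuous y) (hy : ∀ u, HasDerivAt y (-(q u * y u)) u) (hy0 : y 0 = 1) (r : ℝ) :
    (∫ u in (0 : ℝ)..r, y u * p u) + y r * (φ 0 + ∫ u in (0 : ℝ)..r, ℓ u) - φ 0 =
      (∫ u in (0 : ℝ)..r, (φ u - φ 0 - ∫ s in (0 : ℝ)..u, ℓ s) * q u * y u) +
        ∫ u in (0 : ℝ)..r, y u * (p u - q u * φ u + ℓ u) := by
  set I : ℝ → ℝ := fun r ↦ ∫ u in (0 : ℝ)..r, ℓ u with hI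
  have hId : ∀ u, HasDerivAt I (ℓ u) u := hasDerivAt_primitive hℓ
  have cI : Continuous I := continuous_iff_continuousAt.2 fun u ↦ (hId u).continuousAt
  have c1 : Continuous fun u ↦ y u * p u := hyc.mul hp
  have c2 : Continuous fun u ↦ (φ u - φ 0 - I u) * q u * y u := (((hφ.sub continuous_const).sub cI).mul hq).mul hyc
  have c3 : Continuous fun u ↦ y u * (p u - q u * φ u + ℓ u) := hyc.mul ((hp.sub (hq.mul hφ)).add hℓ)
  set F : ℝ → ℝ := fun r ↦ (∫ u in (0 : ℝ)..r, y u * p u) + y r * (φ 0 + I r) - φ 0 -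
    ((∫ u in (0 : ℝ)..r, (φ u - φ 0 - I u) * q u * y u) + ∫ u in (0 : ℝ)..r, y u * (p u - q u * φ u + ℓ u))
    with hF
  have hFd : ∀ r, HasDerivAt F 0 r := by
    intro r
    have h := ((((hasDerivAt_primitive c1 r).add ((hy r).mul ((hId r).const_add (φ 0)))).sub_const (φ 0)).sub
      ((hasDerivAt_primitive c2 r).add (hasDerivAt_primitive c3 r)))
    refine h.congr_deriv ?_
    ring
  have hF0 : F 0 = 0 := by simp [hF, hI, hy0]
  have := eq_zero_of_hasDerivAt_zero hFd hF0 r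
  simp only [hF] at this
  linarith

/-- **First pathwise identity, martingale form**: with `N = φ - φ₀ - I`,
`R_r + y_r φ_r - φ₀ = (y_r N_r + ∫₀ʳ N q y) + ∫₀ʳ y (p - q φ + ℓ)`. [folklore] -/
theorem identity_one (hφ : Continuous φ) (hℓ : Continuous ℓ) (hq : Continuous q) (hp : Continuous p)
    (hyc : Continuous y) (hy : ∀ u, HasDerivAt y (-(q u * y u)) u) (hy0 : y 0 = 1) (r : ℝ) :
    (∫ u in (0 : ℝ)..r, y u * p u) + y r * φ r - φ 0 =
      (y r * (φ r - φ 0 - ∫ u in (0 : ℝ)..r, ℓ u) +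
          ∫ u in (0 : ℝ)..r, (φ u - φ 0 - ∫ s in (0 : ℝ)..u, ℓ s) * q u * y u) +
        ∫ u in (0 : ℝ)..r, y u * (p u - q u * φ u + ℓ u) := by
  have h := smooth_identity_one hφ hℓ hq hp hyc hy hy0 r
  linear_combination h

/-- **Second pathwise identity of the Schramm–Wilson clock** (smooth part), see `identity_two`.
[folklore] -/
theorem smooth_identity_two (hφ : Continuous φ) (hℓ : Continuous ℓ) (hq : Continuous q) (hp : Continuous p)
    (hd : Continuous d) (hyc : Continuous y) (hy : ∀ u, HasDerivAt y (-(q u * y u)) u) (hy0 : y 0 = 1)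
    (κ r : ℝ) :
    let I : ℝ → ℝ := fun r ↦ ∫ u in (0 : ℝ)..r, ℓ u
    let I2 : ℝ → ℝ := fun r ↦ ∫ u in (0 : ℝ)..r, (2 * φ u * ℓ u + κ * d u ^ 2)
    let R : ℝ → ℝ := fun r ↦ ∫ u in (0 : ℝ)..r, y u * p u
    y r ^ 2 * (φ 0 ^ 2 + I2 r) + 2 * R r * y r * (φ 0 + I r) + R r ^ 2 - 2 * φ 0 * R r -
        2 * φ 0 * y r * (φ 0 + I r) + φ 0 ^ 2 - κ * ∫ u in (0 : ℝ)..r, y u ^ 2 * d u ^ 2 =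
      (∫ u in (0 : ℝ)..r, (φ u ^ 2 - φ 0 ^ 2 - I2 u) * (2 * q u * y u ^ 2)) -
        (∫ u in (0 : ℝ)..r, (φ u - φ 0 - I u) * (2 * (y u ^ 2 * p u - R u * q u * y u))) -
        2 * φ 0 * (∫ u in (0 : ℝ)..r, (φ u - φ 0 - I u) * q u * y u) +
        (∫ u in (0 : ℝ)..r, 2 * y u * (y u * φ u + R u) * (p u - q u * φ u + ℓ u)) -
        2 * φ 0 * ∫ u in (0 : ℝ)..r, y u * (p u - q u * φ u + ℓ u) := by
  intro I I2 R
  have hId : ∀ u, HasDerivAt I (ℓ u) u := hasDerivAt_primitive hℓ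
  have cI : Continuous I := continuous_iff_continuousAt.2 fun u ↦ (hId u).continuousAt
  have cℓ2 : Continuous fun u ↦ 2 * φ u * ℓ u + κ * d u ^ 2 :=
    ((continuous_const.mul hφ).mul hℓ).add (continuous_const.mul (hd.pow 2))
  have hI2d : ∀ u, HasDerivAt I2 (2 * φ u * ℓ u + κ * d u ^ 2) u := hasDerivAt_primitive cℓ2
  have cI2 : Continuous I2 := continuous_iff_continuousAt.2 fun u ↦ (hI2d u).continuousAt
  have c1 : Continuous fun u ↦ y u * p u := hyc.mul hp
  have hRd : ∀ u, HasDerivAt R (y u * p u) u := hasDerivAt_primitive c1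
  have cR : Continuous R := continuous_iff_continuousAt.2 fun u ↦ (hRd u).continuousAt
  have c4 : Continuous fun u ↦ y u ^ 2 * d u ^ 2 := (hyc.pow 2).mul (hd.pow 2)
  have c5 : Continuous fun u ↦ (φ u ^ 2 - φ 0 ^ 2 - I2 u) * (2 * q u * y u ^ 2) :=
    (((hφ.pow 2).sub continuous_const).sub cI2).mul ((continuous_const.mul hq).mul (hyc.pow 2))
  have c6 : Continuous fun u ↦ (φ u - φ 0 - I u) * (2 * (y u ^ 2 * p u - R u * q u * y u)) :=
    ((hφ.sub continuous_const).sub cI).mul (continuous_const.mul (((hyc.pow 2).mul hp).sub ((cR.mul hq).mul hyc)))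
  have c7 : Continuous fun u ↦ (φ u - φ 0 - I u) * q u * y u := (((hφ.sub continuous_const).sub cI).mul hq).mul hyc
  have c8 : Continuous fun u ↦ 2 * y u * (y u * φ u + R u) * (p u - q u * φ u + ℓ u) :=
    (((continuous_const.mul hyc).mul ((hyc.mul hφ).add cR)).mul ((hp.sub (hq.mul hφ)).add hℓ))
  have c9 : Continuous fun u ↦ y u * (p u - q u * φ u + ℓ u) := hyc.mul ((hp.sub (hq.mul hφ)).add hℓ)
  set F : ℝ → ℝ := fun r ↦
    y r ^ 2 * (φ 0 ^ 2 + I2 r) + 2 * R r * y r * (φ 0 + I r) + R r ^ 2 - 2 * φ 0 * R r -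
        2 * φ 0 * y r * (φ 0 + I r) + φ 0 ^ 2 - κ * (∫ u in (0 : ℝ)..r, y u ^ 2 * d u ^ 2) -
      ((∫ u in (0 : ℝ)..r, (φ u ^ 2 - φ 0 ^ 2 - I2 u) * (2 * q u * y u ^ 2)) -
        (∫ u in (0 : ℝ)..r, (φ u - φ 0 - I u) * (2 * (y u ^ 2 * p u - R u * q u * y u))) -
        2 * φ 0 * (∫ u in (0 : ℝ)..r, (φ u - φ 0 - I u) * q u * y u) +
        (∫ u in (0 : ℝ)..r, 2 * y u * (y u * φ u + R u) * (p u - q u * φ u + ℓ u)) -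
        2 * φ 0 * ∫ u in (0 : ℝ)..r, y u * (p u - q u * φ u + ℓ u)) with hF
  have hFd : ∀ r, HasDerivAt F 0 r := by
    intro r
    have hy2 : HasDerivAt (fun r ↦ y r ^ 2) (((2 : ℕ) : ℝ) * y r ^ (2 - 1) * -(q r * y r)) r := (hy r).pow 2
    have h := ((((((((hy2.mul ((hI2d r).const_add (φ 0 ^ 2))).add
      ((((hRd r).const_mul 2).mul (hy r)).mul ((hId r).const_add (φ 0)))).add ((hRd r).pow 2)).sub
      ((hRd r).const_mul (2 * φ 0))).sub (((hy r).const_mul (2 * φ 0)).mul ((hId r).const_add (φ 0)))).add_const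
      (φ 0 ^ 2)).sub ((hasDerivAt_primitive c4 r).const_mul κ)).sub
      (((((hasDerivAt_primitive c5 r).sub (hasDerivAt_primitive c6 r)).sub
        ((hasDerivAt_primitive c7 r).const_mul (2 * φ 0))).add (hasDerivAt_primitive c8 r)).sub
        ((hasDerivAt_primitive c9 r).const_mul (2 * φ 0))))
    refine h.congr_deriv ?_
    simp only [Nat.cast_ofNat, Pi.mul_apply, pow_one, Nat.add_one_sub_one]
    ring
  have hF0 : F 0 = 0 := by
    simp only [hF, I, I2, R, integral_same, hy0]
    ring
  have := eq_zero_of_hasDerivAt_zero hFd hF0 r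
  simp only [hF] at this
  linarith

/-- **Second pathwise identity, martingale form**: with `N = φ - φ₀ - I`, `N2 = φ² - φ₀² - I2`,
`A2 = 2 R y`:
`(R_r + y_r φ_r - φ₀)² - κ ∫₀ʳ y² d² = [y_r² N2_r + ∫₀ʳ N2 (2 q y²)] + [A2_r N_r - ∫₀ʳ N a2]
  - 2 φ₀ [y_r N_r + ∫₀ʳ N q y] + ∫₀ʳ 2 y (y φ + R)(p - q φ + ℓ) - 2 φ₀ ∫₀ʳ y (p - q φ + ℓ)`,
`a2 = 2 (y² p - R q y)`. [folklore] -/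
theorem identity_two (hφ : Continuous φ) (hℓ : Continuous ℓ) (hq : Continuous q) (hp : Continuous p)
    (hd : Continuous d) (hyc : Continuous y) (hy : ∀ u, HasDerivAt y (-(q u * y u)) u) (hy0 : y 0 = 1)
    (κ r : ℝ) :
    let I : ℝ → ℝ := fun r ↦ ∫ u in (0 : ℝ)..r, ℓ u
    let I2 : ℝ → ℝ := fun r ↦ ∫ u in (0 : ℝ)..r, (2 * φ u * ℓ u + κ * d u ^ 2)
    let R : ℝ → ℝ := fun r ↦ ∫ u in (0 : ℝ)..r, y u * p u
    ((R r + y r * φ r - φ 0) ^ 2 - κ * ∫ u in (0 : ℝ)..r, y u ^ 2 * d u ^ 2) =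
      (y r ^ 2 * (φ r ^ 2 - φ 0 ^ 2 - I2 r) +
          ∫ u in (0 : ℝ)..r, (φ u ^ 2 - φ 0 ^ 2 - I2 u) * (2 * q u * y u ^ 2)) +
        (2 * R r * y r * (φ r - φ 0 - I r) -
          ∫ u in (0 : ℝ)..r, (φ u - φ 0 - I u) * (2 * (y u ^ 2 * p u - R u * q u * y u))) -
        2 * φ 0 * (y r * (φ r - φ 0 - I r) + ∫ u in (0 : ℝ)..r, (φ u - φ 0 - I u) * q u * y u) +
        ((∫ u in (0 : ℝ)..r, 2 * y u * (y u * φ u + R u) * (p u - q u * φ u + ℓ u)) -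
          2 * φ 0 * ∫ u in (0 : ℝ)..r, y u * (p u - q u * φ u + ℓ u)) := by
  intro I I2 R
  have h := smooth_identity_two hφ hℓ hq hp hd hyc hy hy0 κ r
  simp only at h
  linear_combination h




/-! ### State functions -/

/-- `q(y) = 1 / (2 sin²(y/2))` (`= -d/dy cot(y/2)`). [cite: SchrammWilson2005, §4] -/
def qf (y : ℝ) : ℝ := 1 / (2 * Real.sin (y / 2) ^ 2)

/-- `p(y) = -cos(y/2) / (2 sin³(y/2))` (`= -d²/dy² cot(y/2)`). [cite: SchrammWilson2005, §4] -/
def pf (y : ℝ) : ℝ := -Real.cos (y / 2) / (2 * Real.sin (y / 2) ^ 3)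

/-- The projection onto the band `[a, 2π - a]`. [folklore] -/
def clampBand (a y : ℝ) : ℝ := max a (min y (2 * π - a))

/-- `q` read through the band projection (a globally continuous version). [folklore] -/
def qfc (a y : ℝ) : ℝ := qf (clampBand a y)

/-- `p` read through the band projection. [folklore] -/
def pfc (a y : ℝ) : ℝ := pf (clampBand a y)

/-- `cot(·/2)` read through the band projection. [folklore] -/
def cotc (a y : ℝ) : ℝ := Real.cot (clampBand a y / 2)

variable {a : ℝ}

/-- The band projection is continuous. [folklore] -/
theorem continuous_clampBand (a : ℝ) : Continuous (clampBand a) :=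
  continuous_const.max (continuous_id.min continuous_const)

/-- The band projection takes values in the band. [folklore] -/
theorem clampBand_mem (ha : a ≤ π) (y : ℝ) : clampBand a y ∈ Icc a (2 * π - a) :=
  ⟨le_max_left _ _, max_le (by linarith) (min_le_right _ _)⟩

/-- The band projection fixes the band. [folklore] -/
theorem clampBand_of_mem {y : ℝ} (hy : y ∈ Icc a (2 * π - a)) : clampBand a y = y := by
  rw [clampBand, min_eq_left hy.2, max_eq_right hy.1]

/-- On the band, `sin(y/2) ≥ sin(a/2) > 0`. [folklore] -/
theorem sin_half_ge (ha : 0 < a) (ha' : a ≤ π) {y : ℝ} (hy : y ∈ Icc a (2 * π - a)) :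
    Real.sin (a / 2) ≤ Real.sin (y / 2) := by
  rcases le_total y π with h | h
  · exact Real.sin_le_sin_of_le_of_le_pi_div_two (by linarith) (by linarith) (by linarith [hy.1])
  · rw [← Real.sin_pi_sub (y / 2)]
    exact Real.sin_le_sin_of_le_of_le_pi_div_two (by linarith) (by linarith) (by linarith [hy.2])

/-- `sin(y/2) > 0` on the band. [folklore] -/
theorem sin_half_pos_of_mem (ha : 0 < a) (ha' : a ≤ π) {y : ℝ} (hy : y ∈ Icc a (2 * π - a)) :
    0 < Real.sin (y / 2) :=
  lt_of_lt_of_le (Real.sin_pos_of_pos_of_lt_pi (by linarith) (by linarith)) (sin_half_ge ha ha' hy)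

/-- `q` is continuous on the band. [folklore] -/
theorem continuousOn_qf (ha : 0 < a) (ha' : a ≤ π) : ContinuousOn qf (Icc a (2 * π - a)) := by
  refine continuousOn_const.div ?_ fun y hy ↦ ?_
  · exact (continuous_const.mul ((Real.continuous_sin.comp (continuous_id.div_const _)).pow 2)).continuousOn
  · exact mul_ne_zero two_ne_zero (pow_ne_zero _ (sin_half_pos_of_mem ha ha' hy).ne')

/-- `p` is continuous on the band. [folklore] -/
theorem continuousOn_pf (ha : 0 < a) (ha' : a ≤ π) : ContinuousOn pf (Icc a (2 * π - a)) := by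
  refine ((Real.continuous_cos.comp (continuous_id.div_const _)).neg).continuousOn.div ?_ fun y hy ↦ ?_
  · exact (continuous_const.mul ((Real.continuous_sin.comp (continuous_id.div_const _)).pow 3)).continuousOn
  · exact mul_ne_zero two_ne_zero (pow_ne_zero _ (sin_half_pos_of_mem ha ha' hy).ne')

/-- `cot(·/2)` is continuous on the band. [folklore] -/
theorem continuousOn_cot_half' (ha : 0 < a) (ha' : a ≤ π) :
    ContinuousOn (fun y ↦ Real.cot (y / 2)) (Icc a (2 * π - a)) := by
  have h : ∀ y ∈ Icc a (2 * π - a), Real.cot (y / 2) = Real.cos (y / 2) / Real.sin (y / 2) := fun y _ ↦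
    Real.cot_eq_cos_div_sin _
  refine ContinuousOn.congr ?_ h
  exact (Real.continuous_cos.comp (continuous_id.div_const _)).continuousOn.div
    (Real.continuous_sin.comp (continuous_id.div_const _)).continuousOn
    fun y hy ↦ (sin_half_pos_of_mem ha ha' hy).ne'

/-- The clamped `q` is continuous. [folklore] -/
theorem continuous_qfc (ha : 0 < a) (ha' : a ≤ π) : Continuous (qfc a) :=
  (continuousOn_qf ha ha').comp_continuous (continuous_clampBand a) (clampBand_mem ha')

/-- The clamped `p` is continuous. [folklore] -/
theorem continuous_pfc (ha : 0 < a) (ha' : a ≤ π) : Continuous (pfc a) :=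
  (continuousOn_pf ha ha').comp_continuous (continuous_clampBand a) (clampBand_mem ha')

/-- The clamped `cot(·/2)` is continuous. [folklore] -/
theorem continuous_cotc (ha : 0 < a) (ha' : a ≤ π) : Continuous (cotc a) :=
  (continuousOn_cot_half' ha ha').comp_continuous (continuous_clampBand a) (clampBand_mem ha')

/-- On the band the clamped `q` is `q`. [folklore] -/
theorem qfc_of_mem {y : ℝ} (hy : y ∈ Icc a (2 * π - a)) : qfc a y = qf y := by rw [qfc, clampBand_of_mem hy]
/-- On the band the clamped `p` is `p`. [folklore] -/
theorem pfc_of_mem {y : ℝ} (hy : y ∈ Icc a (2 * π - a)) : pfc a y = pf y := by rw [pfc, clampBand_of_mem hy]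
/-- On the band the clamped `cot(·/2)` is `cot(·/2)`. [folklore] -/
theorem cotc_of_mem {y : ℝ} (hy : y ∈ Icc a (2 * π - a)) : cotc a y = Real.cot (y / 2) := by
  rw [cotc, clampBand_of_mem hy]

/-- `0 < q ≤ 1/(2 sin²(a/2))` on the band. [folklore] -/
theorem qfc_pos (ha : 0 < a) (ha' : a ≤ π) (y : ℝ) : 0 < qfc a y :=
  div_pos one_pos (mul_pos two_pos (pow_pos (sin_half_pos_of_mem ha ha' (clampBand_mem ha' y)) 2))

/-- `q ≤ 1/(2 sin²(a/2))` on the band. [folklore] -/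
theorem qfc_le (ha : 0 < a) (ha' : a ≤ π) (y : ℝ) : qfc a y ≤ 1 / (2 * Real.sin (a / 2) ^ 2) := by
  have hs := sin_half_ge ha ha' (clampBand_mem ha' y)
  have hs0 : 0 < Real.sin (a / 2) := Real.sin_pos_of_pos_of_lt_pi (by linarith) (by linarith)
  unfold qfc qf
  gcongr

/-- `|p| ≤ 1/(2 sin³(a/2))` on the band. [folklore] -/
theorem abs_pfc_le (ha : 0 < a) (ha' : a ≤ π) (y : ℝ) : |pfc a y| ≤ 1 / (2 * Real.sin (a / 2) ^ 3) := by
  have hs := sin_half_ge ha ha' (clampBand_mem ha' y)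
  have hs0 : 0 < Real.sin (a / 2) := Real.sin_pos_of_pos_of_lt_pi (by linarith) (by linarith)
  have hsy : 0 < Real.sin (clampBand a y / 2) := lt_of_lt_of_le hs0 hs
  unfold pfc pf
  rw [abs_div, abs_neg, abs_of_pos (mul_pos two_pos (pow_pos hsy 3))]
  calc |Real.cos (clampBand a y / 2)| / (2 * Real.sin (clampBand a y / 2) ^ 3)
      ≤ 1 / (2 * Real.sin (clampBand a y / 2) ^ 3) := by gcongr; exact Real.abs_cos_le_one _
    _ ≤ 1 / (2 * Real.sin (a / 2) ^ 3) := by gcongr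

/-- `|cot(·/2)| ≤ 1/sin(a/2)` on the band. [folklore] -/
theorem abs_cotc_le (ha : 0 < a) (ha' : a ≤ π) (y : ℝ) : |cotc a y| ≤ 1 / Real.sin (a / 2) := by
  have hs := sin_half_ge ha ha' (clampBand_mem ha' y)
  have hs0 : 0 < Real.sin (a / 2) := Real.sin_pos_of_pos_of_lt_pi (by linarith) (by linarith)
  have hsy : 0 < Real.sin (clampBand a y / 2) := lt_of_lt_of_le hs0 hs
  rw [cotc, Real.cot_eq_cos_div_sin, abs_div, abs_of_pos hsy]
  calc |Real.cos (clampBand a y / 2)| / Real.sin (clampBand a y / 2)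
      ≤ 1 / Real.sin (clampBand a y / 2) := by gcongr; exact Real.abs_cos_le_one _
    _ ≤ 1 / Real.sin (a / 2) := by gcongr

/-! ### Derivatives of `cot(·/2)` -/

/-- `d/dy cot(y/2) = -q(y)` where `sin(y/2) ≠ 0`. [folklore] -/
theorem hasDerivAt_cot_half {y : ℝ} (hy : Real.sin (y / 2) ≠ 0) :
    HasDerivAt (fun y : ℝ ↦ Real.cot (y / 2)) (-qf y) y := by
  have h := HasDerivAt.comp (h₂ := Real.cot) (h := fun z : ℝ ↦ z / 2) y (Real.hasDerivAt_cot hy)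
    ((hasDerivAt_id' y).div_const 2)
  have heq : -(Real.sin (y / 2) ^ 2)⁻¹ * (1 / 2) = -qf y := by
    simp only [qf]
    field_simp
  rw [heq] at h
  exact h

/-- `d/dy (-q(y)) = -p(y)` where `sin(y/2) ≠ 0`. [folklore] -/
theorem hasDerivAt_neg_qf {y : ℝ} (hy : Real.sin (y / 2) ≠ 0) : HasDerivAt (fun y ↦ -qf y) (-pf y) y := by
  have hs : HasDerivAt (fun y : ℝ ↦ Real.sin (y / 2)) (Real.cos (y / 2) * (1 / 2)) y :=
    ((hasDerivAt_id' y).div_const 2).sin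
  have h2 : HasDerivAt (fun y : ℝ ↦ 2 * Real.sin (y / 2) ^ 2)
      (2 * (((2 : ℕ) : ℝ) * Real.sin (y / 2) ^ (2 - 1) * (Real.cos (y / 2) * (1 / 2)))) y :=
    (hs.pow 2).const_mul 2
  have h3 := ((hasDerivAt_const y (1 : ℝ)).div h2 (mul_ne_zero two_ne_zero (pow_ne_zero _ hy))).neg
  have heq : -((0 * (2 * Real.sin (y / 2) ^ 2) -
      1 * (2 * (((2 : ℕ) : ℝ) * Real.sin (y / 2) ^ (2 - 1) * (Real.cos (y / 2) * (1 / 2))))) /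
        (2 * Real.sin (y / 2) ^ 2) ^ 2) = -pf y := by
    simp only [pf, Nat.cast_ofNat, Nat.add_one_sub_one, pow_one]
    field_simp
    ring
  rw [heq] at h3
  refine h3.congr_of_eventuallyEq (Eventually.of_forall fun z ↦ ?_)
  simp only [qf, Pi.neg_apply, Pi.div_apply]

/-- `cot(·/2)` is smooth on `(0, 2π)`. [folklore] -/
theorem contDiffOn_cot_half {n : ℕ∞} : ContDiffOn ℝ n (fun y : ℝ ↦ Real.cot (y / 2)) (Ioo 0 (2 * π)) := by
  have h : ∀ y ∈ Ioo (0 : ℝ) (2 * π), Real.cot (y / 2) = Real.cos (y / 2) / Real.sin (y / 2) := fun y _ ↦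
    Real.cot_eq_cos_div_sin _
  refine ContDiffOn.congr ?_ h
  refine ContDiffOn.div ?_ ?_ fun y hy ↦ ?_
  · exact (Real.contDiff_cos.comp (contDiff_id.div_const _)).contDiffOn
  · exact (Real.contDiff_sin.comp (contDiff_id.div_const _)).contDiffOn
  · exact (Real.sin_pos_of_pos_of_lt_pi (by linarith [hy.1]) (by linarith [hy.2])).ne'

/-! ### The test function `f = cot(·/2) · bump` -/

section TestFunction

variable (b : ContDiffBump (π : ℝ))

/-- A smooth function on a neighbourhood of the support of a bump, times the bump, is smooth.
[folklore] -/
theorem contDiff_mul_bump_of_contDiffOn {g : ℝ → ℝ} {n : ℕ∞} {U : Set ℝ} (hU : IsOpen U)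
    (hsub : closedBall (π : ℝ) b.rOut ⊆ U) (hg : ContDiffOn ℝ n g U) :
    ContDiff ℝ n fun y ↦ g y * b y := by
  refine contDiff_iff_contDiffAt.2 fun y ↦ ?_
  by_cases hy : y ∈ U
  · exact (hg.contDiffAt (hU.mem_nhds hy)).mul b.contDiff.contDiffAt
  · have hy' : y ∉ closedBall (π : ℝ) b.rOut := fun h ↦ hy (hsub h)
    have hev : (fun y ↦ g y * b y) =ᶠ[𝓝 y] fun _ ↦ 0 := by
      filter_upwards [isClosed_closedBall.isOpen_compl.mem_nhds hy'] with z hz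
      have : b z = 0 := by
        have hz' : z ∉ Function.support b := by rw [b.support_eq]; exact fun h ↦ hz (ball_subset_closedBall h)
        simpa [Function.mem_support] using hz'
      rw [this, mul_zero]
    exact (contDiffAt_const (c := (0 : ℝ))).congr_of_eventuallyEq hev

/-- The test function `f(y) = cot(y/2) b(y)`. [cite: SchrammWilson2005, §4] -/
def testFn (y : ℝ) : ℝ := Real.cot (y / 2) * b y

variable {b}

/-- The test function is smooth (the bump is supported inside `(0, 2π)`). [folklore] -/
theorem contDiff_testFn {n : ℕ∞} (hb : b.rOut < π) : ContDiff ℝ n (testFn b) := by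
  refine contDiff_mul_bump_of_contDiffOn b isOpen_Ioo (fun y hy ↦ ?_) contDiffOn_cot_half
  rw [mem_closedBall, Real.dist_eq, abs_le] at hy
  constructor <;> linarith [hy.1, hy.2]

/-- The test function is supported in the closed ball of the bump. [folklore] -/
theorem tsupport_testFn_subset : tsupport (testFn b) ⊆ closedBall (π : ℝ) b.rOut :=
  tsupport_mul_subset_right.trans b.tsupport_eq.le

/-- Near a point of the inner ball the test function is `cot(·/2)`. [folklore] -/
theorem testFn_eventuallyEq {y : ℝ} (hy : y ∈ ball (π : ℝ) b.rIn) :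
    testFn b =ᶠ[𝓝 y] fun y ↦ Real.cot (y / 2) := by
  filter_upwards [isOpen_ball.mem_nhds hy] with z hz
  rw [testFn, b.one_of_mem_closedBall (ball_subset_closedBall hz), mul_one]

/-- On the inner ball the test function is `cot(·/2)`. [folklore] -/
theorem testFn_apply {y : ℝ} (hy : y ∈ ball (π : ℝ) b.rIn) : testFn b y = Real.cot (y / 2) :=
  (testFn_eventuallyEq hy).self_of_nhds

/-- On the inner ball `sin(y/2) ≠ 0`. [folklore] -/
theorem sin_half_ne_zero_of_mem_ball (hb : b.rIn ≤ π) {y : ℝ} (hy : y ∈ ball (π : ℝ) b.rIn) :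
    Real.sin (y / 2) ≠ 0 := by
  rw [mem_ball, Real.dist_eq, abs_lt] at hy
  exact (Real.sin_pos_of_pos_of_lt_pi (by linarith [hy.1]) (by linarith [hy.2])).ne'

/-- On the inner ball `f' = -q`. [folklore] -/
theorem deriv_testFn (hb : b.rIn ≤ π) {y : ℝ} (hy : y ∈ ball (π : ℝ) b.rIn) : deriv (testFn b) y = -qf y := by
  rw [(testFn_eventuallyEq hy).deriv_eq]
  exact (hasDerivAt_cot_half (sin_half_ne_zero_of_mem_ball hb hy)).deriv

/-- On the inner ball `f'' = -p`. [folklore] -/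
theorem iteratedDeriv_two_testFn (hb : b.rIn ≤ π) {y : ℝ} (hy : y ∈ ball (π : ℝ) b.rIn) :
    iteratedDeriv 2 (testFn b) y = -pf y := by
  rw [iteratedDeriv_succ, iteratedDeriv_one]
  have hev : deriv (testFn b) =ᶠ[𝓝 y] fun y ↦ -qf y := by
    filter_upwards [isOpen_ball.mem_nhds hy] with z hz using deriv_testFn hb hz
  rw [hev.deriv_eq]
  exact (hasDerivAt_neg_qf (sin_half_ne_zero_of_mem_ball hb hy)).deriv

/-- **The drift vanishes**: on the inner ball, with `f = cot(·/2)` there,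
`p - q f + L_{κ-6} f = 0` (`L_ρ = (κ/2)∂² + ((ρ+2)/2) cot(·/2) ∂`; the identity
`c'' + c c' = 0` for `c = cot(·/2)`). [cite: SchrammWilson2005, §4 Thm. 3] -/
theorem drift_eq_zero (κ : ℝ≥0) (hb : b.rIn ≤ π) {y : ℝ} (hy : y ∈ ball (π : ℝ) b.rIn) :
    pf y - qf y * testFn b y + angleGenerator κ ((κ : ℝ) - 6) (testFn b) y = 0 := by
  have hs := sin_half_ne_zero_of_mem_ball hb hy
  rw [angleGenerator, deriv_testFn hb hy, iteratedDeriv_two_testFn hb hy, testFn_apply hy,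
    Real.cot_eq_cos_div_sin, pf, qf]
  field_simp
  ring

/-- `(f')² = q²` on the inner ball. [folklore] -/
theorem deriv_testFn_sq (hb : b.rIn ≤ π) {y : ℝ} (hy : y ∈ ball (π : ℝ) b.rIn) :
    deriv (testFn b) y ^ 2 = qf y ^ 2 := by
  rw [deriv_testFn hb hy, neg_sq]

end TestFunction




/-! ### Conversion of killed time integrals to path integrals -/

section Killed

variable {Ω : Type*}

/-- **A killed time integral is a path integral up to `t ∧ T`**: if `G` read at real times
`u ∈ [0, T]` is the path function `g`, then `∫₀ᵗ 𝟙_{s ≤ T} G_s ds = ∫₀^{t ∧ T} g`. [folklore] -/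
theorem timeIntegral_killed_eq {G : ℝ≥0 → Ω → ℝ} {g : ℝ → ℝ} {T : ℝ≥0} {ω : Ω}
    (hG : ∀ u : ℝ, 0 ≤ u → u ≤ T → G u.toNNReal ω = g u) (t : ℝ≥0) :
    timeIntegral (fun s ω ↦ if s ≤ T then G s ω else 0) t ω = ∫ u in (0 : ℝ)..((min t T : ℝ≥0) : ℝ), g u := by
  rw [timeIntegral_ite_le G T t ω, timeIntegral_apply_eq_intervalIntegral]
  refine intervalIntegral.integral_congr fun u hu ↦ ?_
  rw [uIcc_of_le (min t T).coe_nonneg] at hu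
  exact hG u hu.1 (hu.2.trans (by exact_mod_cast min_le_right t T))

/-- The same at a time `s ≤ T`, read at the real time `s`. [folklore] -/
theorem timeIntegral_killed_eq_of_le {G : ℝ≥0 → Ω → ℝ} {g : ℝ → ℝ} {T : ℝ≥0} {ω : Ω}
    (hG : ∀ u : ℝ, 0 ≤ u → u ≤ T → G u.toNNReal ω = g u) {u : ℝ} (hu0 : 0 ≤ u) (huT : u ≤ T) :
    timeIntegral (fun s ω ↦ if s ≤ T then G s ω else 0) u.toNNReal ω = ∫ v in (0 : ℝ)..u, g v := by
  rw [timeIntegral_killed_eq hG, min_eq_left (Real.toNNReal_le_iff_le_coe.2 huT), Real.coe_toNNReal _ hu0]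

/-- An unkilled time integral at a time `≤ T` read at a real time. [folklore] -/
theorem timeIntegral_toNNReal_eq {G : ℝ≥0 → Ω → ℝ} {g : ℝ → ℝ} {T : ℝ≥0} {ω : Ω}
    (hG : ∀ u : ℝ, 0 ≤ u → u ≤ T → G u.toNNReal ω = g u) {u : ℝ} (hu0 : 0 ≤ u) (huT : u ≤ T) :
    timeIntegral G u.toNNReal ω = ∫ v in (0 : ℝ)..u, g v := by
  rw [timeIntegral_apply_eq_intervalIntegral, Real.coe_toNNReal _ hu0]
  refine intervalIntegral.integral_congr fun v hv ↦ ?_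
  rw [uIcc_of_le hu0] at hv
  exact hG v hv.1 (hv.2.trans huT)

end Killed

/-! ### The processes -/

section Defs

variable {Ω : Type*}

/-- The killed clock-rate factor `𝟙_{s ≤ T} q(X_s)`. [folklore] -/
def qKill (a : ℝ) (T : ℝ≥0) (X : ℝ≥0 → Ω → ℝ) : ℝ≥0 → Ω → ℝ :=
  fun s ω ↦ if s ≤ T then qfc a (X s ω) else 0

/-- **`𝒴_t = exp(-∫₀^{t∧T} ds / (2 sin²(X_s/2)))`** — the imaginary part of the image of the radial
target under the chordal map (Schramm–Wilson), as a process. [cite: SchrammWilson2005, §4] -/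
def yProc (a : ℝ) (T : ℝ≥0) (X : ℝ≥0 → Ω → ℝ) : ℝ≥0 → Ω → ℝ :=
  fun t ω ↦ Real.exp (-timeIntegral (qKill a T X) t ω)

/-- The killed integrand of the real part, `𝟙_{s ≤ T} 𝒴_s p(X_s)`. [folklore] -/
def pKill (a : ℝ) (T : ℝ≥0) (X : ℝ≥0 → Ω → ℝ) : ℝ≥0 → Ω → ℝ :=
  fun s ω ↦ if s ≤ T then yProc a T X s ω * pfc a (X s ω) else 0

/-- **`R_t = -∫₀^{t∧T} 𝒴_s cos(X_s/2) / (2 sin³(X_s/2)) ds`** — the real part of the image of the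
radial target. [cite: SchrammWilson2005, §4] -/
def rProc (a : ℝ) (T : ℝ≥0) (X : ℝ≥0 → Ω → ℝ) : ℝ≥0 → Ω → ℝ := timeIntegral (pKill a T X)

/-- **The chordal driving function in radial time**, `W_t = R_t + 𝒴_t cot(X_{t∧T}/2)`.
[cite: SchrammWilson2005, §4 Thm. 3] -/
def wProc (a : ℝ) (T : ℝ≥0) (X : ℝ≥0 → Ω → ℝ) : ℝ≥0 → Ω → ℝ :=
  fun t ω ↦ rProc a T X t ω + yProc a T X t ω * cotc a (X (min t T) ω)

/-- The killed clock rate `𝟙_{s ≤ T} 𝒴_s² q(X_s)²`. [folklore] -/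
def cKill (a : ℝ) (T : ℝ≥0) (X : ℝ≥0 → Ω → ℝ) : ℝ≥0 → Ω → ℝ :=
  fun s ω ↦ if s ≤ T then yProc a T X s ω ^ 2 * qfc a (X s ω) ^ 2 else 0

/-- **The half-plane capacity clock** `τ_t = ∫₀^{t∧T} 𝒴_s² / (4 sin⁴(X_s/2)) ds`.
[cite: SchrammWilson2005, §4] -/
def clockProc (a : ℝ) (T : ℝ≥0) (X : ℝ≥0 → Ω → ℝ) : ℝ≥0 → Ω → ℝ := timeIntegral (cKill a T X)

/-- The bound `Q₀ = 1/(2 sin²(a/2))` of the clock-rate factor on the band. [folklore] -/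
def rateBound (a : ℝ) : ℝ := 1 / (2 * Real.sin (a / 2) ^ 2)

/-- The exit time of `X` from `(2ε, 2π - 2ε)` (`Process.exitTime`; a stopping time of any
filtration to which the continuous process `X` is adapted). [folklore] -/
def bandExit (ε : ℝ) (X : ℝ≥0 → Ω → ℝ) : Ω → WithTop ℝ≥0 :=
  Process.exitTime X (2 * ε) (2 * π - 2 * ε)

/-- **The normalised chordal driving increment** `(W_t - W_0)/√(κ Q₀²)`. [folklore] -/
def swMart (κ : ℝ≥0) (a : ℝ) (T : ℝ≥0) (X : ℝ≥0 → Ω → ℝ) : ℝ≥0 → Ω → ℝ :=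
  fun t ω ↦ (wProc a T X t ω - wProc a T X 0 ω) / Real.sqrt (κ * rateBound a ^ 2)

/-- **The normalised clock**, stopped at the band exit: `τ_{t ∧ S ∧ T} / Q₀²`. [folklore] -/
def swClock (a : ℝ) (T : ℝ≥0) (ε : ℝ) (X : ℝ≥0 → Ω → ℝ) : ℝ≥0 → Ω → ℝ :=
  fun t ω ↦ clockProc a T X ((min (t : WithTop ℝ≥0) (bandExit ε X ω)).untopA) ω / rateBound a ^ 2

end Defs

/-! ### The theorem -/

section Main

variable {Ω : Type*} {m : MeasurableSpace Ω} {𝓕 : Filtration ℝ≥0 m} {Q : Measure Ω}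
  {X : ℝ≥0 → Ω → ℝ} {κ : ℝ≥0} {a ε : ℝ}

/-- **The Schramm–Wilson clock (martingale-problem form).** Let `X` be a continuous progressive
process with values in the band `[a, 2π - a]` on a filtered probability space `(Ω, 𝓕, Q)` which
solves the SLE_κ(κ - 6) angle martingale problem up to the horizon `T` for test functions supported
in `(ε, 2π - ε)`: for every such `C²` `f`,
`f(X_{t∧T}) - f(X_0) - ∫₀^{t∧T} L_{κ-6} f(X_s) ds` is a martingale (the output of
`exists_tilted_measure_target`). Let `𝒴, R, W = R + 𝒴 cot(X/2), τ` be the Schramm–Wilson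
functionals of `X` (`yProc`, `rProc`, `wProc`, `clockProc`) and `S` the exit time of `X` from
`[2ε, 2π - 2ε]` (`bandExit`). Then the normalised increment `(W - W_0)^S / √(κ Q₀²)` is a bounded
continuous `𝓕`-martingale with the `1`-Lipschitz clock `τ^{S∧T}/Q₀²`, `Q₀ = 1/(2 sin²(a/2))`
(`HasMartingaleClock`): `W^S` is a martingale with quadratic variation `κ τ^S` — the
martingale-problem form of Schramm–Wilson's theorem that radial SLE_κ read in the half-plane is a
time change of chordal SLE_κ(κ - 6). Proof: with the test functions `f = cot(·/2)·(bump)` and `f²`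
(martingale problem), integration by parts against the `C¹` processes `𝒴, 2R𝒴, 𝒴²`
(`martingale_mul_timeIntegral_sub`), the pathwise identities `identity_one` / `identity_two`, the
cancellation `p - q cot(·/2) + L_{κ-6} cot(·/2) = 0` (`drift_eq_zero`) and `(cot(·/2)')² = q²`,
and optional stopping at `S`. [cite: SchrammWilson2005, §4 Thm. 3] -/
theorem hasMartingaleClock_swMart [IsProbabilityMeasure Q] (hκ : 0 < κ)
    (hX : IsStronglyProgressive 𝓕 X) (hXc : ∀ ω, Continuous (X · ω))
    (ha : 0 < a) (ha' : a ≤ π) (hXband : ∀ t ω, X t ω ∈ Icc a (2 * π - a))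
    (hε : 0 < ε) (hε2 : ε < π / 2) (T : ℝ≥0)
    (hMP : ∀ f : ℝ → ℝ, ContDiff ℝ 2 f → tsupport f ⊆ Ioo ε (2 * π - ε) →
      Martingale (fun (t : ℝ≥0) ω ↦ f (X (min t T) ω) - f (X 0 ω) -
        timeIntegral (fun s ω ↦ angleGenerator κ ((κ : ℝ) - 6) f (X s ω)) (min t T) ω) 𝓕 Q) :
    HasMartingaleClock (stoppedProcess (swMart κ a T X) (bandExit ε X)) (swClock a T ε X) 𝓕 Q
      (2 * (T * (1 / (2 * Real.sin (a / 2) ^ 3)) + 1 / Real.sin (a / 2)) /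
        Real.sqrt (κ * rateBound a ^ 2)) := by
  -- constants
  set Q₀ : ℝ := rateBound a with hQ₀def
  set P₀ : ℝ := 1 / (2 * Real.sin (a / 2) ^ 3) with hP₀def
  set C₀ : ℝ := 1 / Real.sin (a / 2) with hC₀def
  have hsa : 0 < Real.sin (a / 2) := Real.sin_pos_of_pos_of_lt_pi (by linarith) (by linarith)
  have hQ₀ : 0 < Q₀ := by rw [hQ₀def, rateBound]; positivity
  have hqle : ∀ y, qfc a y ≤ Q₀ := fun y ↦ by rw [hQ₀def, rateBound]; exact qfc_le ha ha' y
  have hP₀ : 0 < P₀ := by positivity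
  have hC₀ : 0 < C₀ := by positivity
  set K : ℝ := Q₀ ^ 2 with hKdef
  have hK : 0 < K := by positivity
  have hκK : 0 < (κ : ℝ) * K := mul_pos (by exact_mod_cast hκ) hK
  set L : ℝ := Real.sqrt (κ * rateBound a ^ 2) with hLdef
  have hL : 0 < L := Real.sqrt_pos.2 hκK
  have hL2 : L ^ 2 = κ * K := Real.sq_sqrt hκK.le
  -- the test functions
  let b : ContDiffBump (π : ℝ) := ⟨π - 3 * ε / 2, π - 5 * ε / 4, by linarith, by linarith⟩
  have hbIn : b.rIn = π - 3 * ε / 2 := rfl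
  have hbOut : b.rOut = π - 5 * ε / 4 := rfl
  have hbInπ : b.rIn ≤ π := by rw [hbIn]; linarith
  set f : ℝ → ℝ := testFn b with hfdef
  set f2 : ℝ → ℝ := fun y ↦ f y ^ 2 with hf2def
  have hfC : ContDiff ℝ 2 f := contDiff_testFn (by rw [hbOut]; linarith)
  have hf2C : ContDiff ℝ 2 f2 := hfC.pow 2
  have hsupp : tsupport f ⊆ Ioo ε (2 * π - ε) := by
    refine tsupport_testFn_subset.trans fun y hy ↦ ?_
    rw [mem_closedBall, Real.dist_eq, hbOut, abs_le] at hy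
    constructor <;> linarith [hy.1, hy.2]
  have hsupp2 : tsupport f2 ⊆ Ioo ε (2 * π - ε) := by
    refine Subset.trans ?_ hsupp
    simp only [hf2def, sq]
    exact tsupport_mul_subset_left
  have hIoo : Ioo ε (2 * π - ε) ⊆ Ioo 0 (2 * π) := Ioo_subset_Ioo hε.le (by linarith)
  have hsupp' := hsupp.trans hIoo
  have hsupp2' := hsupp2.trans hIoo
  have hcpt : HasCompactSupport f := hasCompactSupport_of_tsupport_subset_Ioo hsupp
  have hcpt2 : HasCompactSupport f2 := hasCompactSupport_of_tsupport_subset_Ioo hsupp2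
  obtain ⟨Cf, hCf0, hCf⟩ := exists_bound_of_hasCompactSupport hfC.continuous hcpt
  obtain ⟨CL, hCL0, hCL⟩ := exists_bound_angleGenerator (κ := κ) (ρ := (κ : ℝ) - 6) hfC hcpt hsupp'
  obtain ⟨CL2, hCL20, hCL2⟩ := exists_bound_angleGenerator (κ := κ) (ρ := (κ : ℝ) - 6) hf2C hcpt2 hsupp2'
  have hLc : Continuous (angleGenerator κ ((κ : ℝ) - 6) f) := continuous_angleGenerator hfC hsupp'
  have hL2c : Continuous (angleGenerator κ ((κ : ℝ) - 6) f2) := continuous_angleGenerator hf2C hsupp2'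
  have hdc : Continuous (deriv f) := hfC.continuous_deriv (by norm_num)
  have hf2b : ∀ y, |f2 y| ≤ Cf ^ 2 := fun y ↦ by
    rw [hf2def]; simp only [abs_pow]; exact pow_le_pow_left₀ (abs_nonneg _) (hCf y) 2
  -- points of `[2ε, 2π - 2ε]` are in the inner ball
  have hball : ∀ {y : ℝ}, |y - π| ≤ π - 2 * ε → y ∈ ball (π : ℝ) b.rIn := fun hy ↦ by
    rw [hbIn]; exact mem_ball_of_abs_sub_pi_le hε hy
  -- the two martingales of the martingale problem
  have hN1 := hMP f hfC hsupp
  have hN2 := hMP f2 hf2C hsupp2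
  set N : ℝ≥0 → Ω → ℝ := fun t ω ↦ f (X (min t T) ω) - f (X 0 ω) -
    timeIntegral (fun s ω ↦ angleGenerator κ ((κ : ℝ) - 6) f (X s ω)) (min t T) ω with hNdef
  set N2 : ℝ≥0 → Ω → ℝ := fun t ω ↦ f2 (X (min t T) ω) - f2 (X 0 ω) -
    timeIntegral (fun s ω ↦ angleGenerator κ ((κ : ℝ) - 6) f2 (X s ω)) (min t T) ω with hN2def
  -- progressivity of the martingale-problem processes
  have progMP : ∀ {g : ℝ → ℝ}, ContDiff ℝ 2 g → tsupport g ⊆ Ioo 0 (2 * π) →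
      IsStronglyProgressive 𝓕 fun (t : ℝ≥0) ω ↦ g (X (min t T) ω) - g (X 0 ω) -
        timeIntegral (fun s ω ↦ angleGenerator κ ((κ : ℝ) - 6) g (X s ω)) (min t T) ω := by
    intro g hg hgs
    have h1 : IsStronglyProgressive 𝓕 fun (t : ℝ≥0) ω ↦ g (X t ω) - g (X 0 ω) -
        timeIntegral (fun s ω ↦ angleGenerator κ ((κ : ℝ) - 6) g (X s ω)) t ω :=
      ((IsStronglyProgressive.continuous_comp hX hg.continuous).sub
        (IsStronglyProgressive.continuous_comp hX.initial hg.continuous)).sub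
        (isStronglyProgressive_timeIntegral
          (IsStronglyProgressive.continuous_comp hX (continuous_angleGenerator hg hgs)))
    exact h1.min_const T
  have hNprog : IsStronglyProgressive 𝓕 N := progMP hfC hsupp'
  have hN2prog : IsStronglyProgressive 𝓕 N2 := progMP hf2C hsupp2'
  have boundMP : ∀ {g : ℝ → ℝ} {Cg Cl : ℝ}, (∀ y, |g y| ≤ Cg) →
      (∀ y, |angleGenerator κ ((κ : ℝ) - 6) g y| ≤ Cl) → ∀ (t : ℝ≥0) ω,
      |g (X (min t T) ω) - g (X 0 ω) -
        timeIntegral (fun s ω ↦ angleGenerator κ ((κ : ℝ) - 6) g (X s ω)) (min t T) ω| ≤ 2 * Cg + Cl * T := by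
    intro g Cg Cl hg hl t ω
    have h3 := abs_timeIntegral_le (g := fun s ω ↦ angleGenerator κ ((κ : ℝ) - 6) g (X s ω))
      (fun s ω ↦ hl _) (min t T) ω
    have hCl0 : 0 ≤ Cl := (abs_nonneg _).trans (hl 0)
    calc _ ≤ |g (X (min t T) ω) - g (X 0 ω)| +
          |timeIntegral (fun s ω ↦ angleGenerator κ ((κ : ℝ) - 6) g (X s ω)) (min t T) ω| := abs_sub _ _
      _ ≤ (|g (X (min t T) ω)| + |g (X 0 ω)|) + Cl * (min t T : ℝ≥0) := add_le_add (abs_sub _ _) h3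
      _ ≤ 2 * Cg + Cl * T := by
        have : Cl * ((min t T : ℝ≥0) : ℝ) ≤ Cl * T :=
          mul_le_mul_of_nonneg_left (by exact_mod_cast min_le_right t T) hCl0
        linarith [hg (X (min t T) ω), hg (X 0 ω)]
  have hNb : ∀ t ω, |N t ω| ≤ 2 * Cf + CL * T := boundMP hCf hCL
  have hN2b : ∀ t ω, |N2 t ω| ≤ 2 * Cf ^ 2 + CL2 * T := boundMP hf2b hCL2
  -- the `C¹` processes and their killed derivatives
  have hqc := continuous_qfc ha ha'
  have hpc := continuous_pfc ha ha'
  have hcc := continuous_cotc ha ha'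
  set qX := qKill a T X with hqXdef
  have hqXprog : IsStronglyProgressive 𝓕 qX := (IsStronglyProgressive.continuous_comp hX hqc).indicator_le_const T
  set Yp := yProc a T X with hYpdef
  have hYprog : IsStronglyProgressive 𝓕 Yp :=
    IsStronglyProgressive.continuous_comp (isStronglyProgressive_timeIntegral hqXprog)
      (Real.continuous_exp.comp continuous_neg)
  have hIq0 : ∀ t ω, 0 ≤ timeIntegral qX t ω := fun t ω ↦ by
    rw [timeIntegral_apply_eq_intervalIntegral]
    refine intervalIntegral.integral_nonneg t.coe_nonneg fun u _ ↦ ?_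
    simp only [hqXdef, qKill]
    split_ifs
    · exact (qfc_pos ha ha' _).le
    · exact le_rfl
  have hYpos : ∀ t ω, 0 < Yp t ω := fun t ω ↦ Real.exp_pos _
  have hYle : ∀ t ω, Yp t ω ≤ 1 := fun t ω ↦ by
    simp only [hYpdef, yProc]
    rw [← hqXdef]
    exact Real.exp_le_one_iff.2 (by linarith [hIq0 t ω])
  have hYabs : ∀ t ω, |Yp t ω| ≤ 1 := fun t ω ↦ by rw [abs_of_pos (hYpos t ω)]; exact hYle t ω
  set pX := pKill a T X with hpXdef
  have hpXprog : IsStronglyProgressive 𝓕 pX :=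
    (hYprog.mul (IsStronglyProgressive.continuous_comp hX hpc)).indicator_le_const T
  set Rp := rProc a T X with hRpdef
  have hRprog : IsStronglyProgressive 𝓕 Rp := isStronglyProgressive_timeIntegral hpXprog
  have hRb : ∀ t ω, |Rp t ω| ≤ P₀ * T := fun t ω ↦ by
    show |timeIntegral (fun s ω ↦ if s ≤ T then yProc a T X s ω * pfc a (X s ω) else 0) t ω| ≤ _
    rw [timeIntegral_ite_le (fun s ω ↦ yProc a T X s ω * pfc a (X s ω)) T t ω]
    have h := abs_timeIntegral_le (g := fun s ω ↦ yProc a T X s ω * pfc a (X s ω)) (C := P₀)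
      (fun s ω ↦ by
        rw [abs_mul]
        calc |yProc a T X s ω| * |pfc a (X s ω)| ≤ 1 * P₀ :=
              mul_le_mul (hYabs s ω) (abs_pfc_le ha ha' _) (abs_nonneg _) zero_le_one
          _ = P₀ := one_mul _) (min t T) ω
    exact h.trans (mul_le_mul_of_nonneg_left (by exact_mod_cast min_le_right t T) hP₀.le)
  set h₁ : ℝ≥0 → Ω → ℝ := fun s ω ↦ if s ≤ T then -(qfc a (X s ω) * Yp s ω) else 0 with hh₁def
  have hY2prog : IsStronglyProgressive 𝓕 fun s ω ↦ Yp s ω ^ 2 :=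
    IsStronglyProgressive.continuous_comp hYprog (continuous_pow 2)
  have hqXc : IsStronglyProgressive 𝓕 fun s ω ↦ qfc a (X s ω) := IsStronglyProgressive.continuous_comp hX hqc
  have hpXc : IsStronglyProgressive 𝓕 fun s ω ↦ pfc a (X s ω) := IsStronglyProgressive.continuous_comp hX hpc
  have hh₁prog : IsStronglyProgressive 𝓕 h₁ :=
    (IsStronglyProgressive.continuous_comp (hqXc.mul hYprog) continuous_neg).indicator_le_const T
  have hh₁b : ∀ s ω, |h₁ s ω| ≤ Q₀ := fun s ω ↦ by
    simp only [hh₁def]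
    split_ifs
    · rw [abs_neg, abs_mul, abs_of_pos (qfc_pos ha ha' _)]
      calc qfc a (X s ω) * |Yp s ω| ≤ Q₀ * 1 :=
            mul_le_mul (hqle _) (hYabs s ω) (abs_nonneg _) hQ₀.le
        _ = Q₀ := mul_one _
    · rw [abs_zero]; exact hQ₀.le
  set a2 : ℝ≥0 → Ω → ℝ := fun s ω ↦
    if s ≤ T then 2 * (Yp s ω ^ 2 * pfc a (X s ω) - Rp s ω * qfc a (X s ω) * Yp s ω) else 0 with ha2def
  have ha2prog : IsStronglyProgressive 𝓕 a2 :=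
    (IsStronglyProgressive.continuous_comp ((hY2prog.mul hpXc).sub ((hRprog.mul hqXc).mul hYprog))
      (continuous_const.mul continuous_id : Continuous fun x : ℝ ↦ 2 * x)).indicator_le_const T
  have ha2b : ∀ s ω, |a2 s ω| ≤ 2 * (P₀ + P₀ * T * Q₀) := fun s ω ↦ by
    simp only [ha2def]
    split_ifs
    · rw [abs_mul, abs_two]
      refine mul_le_mul_of_nonneg_left ?_ zero_le_two
      have h1 : |Yp s ω ^ 2 * pfc a (X s ω)| ≤ P₀ := by
        rw [abs_mul, abs_pow]
        calc |Yp s ω| ^ 2 * |pfc a (X s ω)| ≤ 1 ^ 2 * P₀ :=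
              mul_le_mul (pow_le_pow_left₀ (abs_nonneg _) (hYabs s ω) 2) (abs_pfc_le ha ha' _)
                (abs_nonneg _) (by positivity)
          _ = P₀ := by ring
      have h2 : |Rp s ω * qfc a (X s ω) * Yp s ω| ≤ P₀ * T * Q₀ := by
        rw [abs_mul, abs_mul, abs_of_pos (qfc_pos ha ha' _)]
        calc |Rp s ω| * qfc a (X s ω) * |Yp s ω| ≤ P₀ * T * Q₀ * 1 :=
              mul_le_mul (mul_le_mul (hRb s ω) (hqle _) (qfc_pos ha ha' _).le (by positivity))
                (hYabs s ω) (abs_nonneg _) (by positivity)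
          _ = P₀ * T * Q₀ := mul_one _
      exact (abs_sub _ _).trans (add_le_add h1 h2)
    · rw [abs_zero]; positivity
  set h₃ : ℝ≥0 → Ω → ℝ := fun s ω ↦ if s ≤ T then -(2 * qfc a (X s ω) * Yp s ω ^ 2) else 0 with hh₃def
  have hh₃prog : IsStronglyProgressive 𝓕 h₃ :=
    (IsStronglyProgressive.continuous_comp
      ((IsStronglyProgressive.continuous_comp hqXc
        (continuous_const.mul continuous_id : Continuous fun x : ℝ ↦ 2 * x)).mul hY2prog)
      continuous_neg).indicator_le_const T
  have hh₃b : ∀ s ω, |h₃ s ω| ≤ 2 * Q₀ := fun s ω ↦ by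
    simp only [hh₃def]
    split_ifs
    · rw [abs_neg, abs_mul, abs_mul, abs_two, abs_of_pos (qfc_pos ha ha' _), abs_pow]
      calc 2 * qfc a (X s ω) * |Yp s ω| ^ 2 ≤ 2 * Q₀ * 1 ^ 2 :=
            mul_le_mul (mul_le_mul_of_nonneg_left (hqle _) zero_le_two)
              (pow_le_pow_left₀ (abs_nonneg _) (hYabs s ω) 2) (by positivity) (by positivity)
        _ = 2 * Q₀ := by ring
    · rw [abs_zero]; positivity
  -- the three integration-by-parts martingales
  have hP1m := martingale_mul_timeIntegral_sub hN1 hNprog (IsStronglyProgressive.measurable_uncurry hNprog) hNb hh₁prog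
    (IsStronglyProgressive.measurable_uncurry hh₁prog) hh₁b
  have hP2m := martingale_mul_timeIntegral_sub hN1 hNprog (IsStronglyProgressive.measurable_uncurry hNprog) hNb ha2prog
    (IsStronglyProgressive.measurable_uncurry ha2prog) ha2b
  have hP3m := martingale_mul_timeIntegral_sub hN2 hN2prog (IsStronglyProgressive.measurable_uncurry hN2prog) hN2b hh₃prog
    (IsStronglyProgressive.measurable_uncurry hh₃prog) hh₃b
  set P1m : ℝ≥0 → Ω → ℝ := fun t ω ↦ N t ω * timeIntegral h₁ t ω - timeIntegral (fun s ω ↦ N s ω * h₁ s ω) t ω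
    with hP1mdef
  set P2m : ℝ≥0 → Ω → ℝ := fun t ω ↦ N t ω * timeIntegral a2 t ω - timeIntegral (fun s ω ↦ N s ω * a2 s ω) t ω
    with hP2mdef
  set P3m : ℝ≥0 → Ω → ℝ := fun t ω ↦ N2 t ω * timeIntegral h₃ t ω - timeIntegral (fun s ω ↦ N2 s ω * h₃ s ω) t ω
    with hP3mdef
  -- the two true martingales
  set Z1 : ℝ≥0 → Ω → ℝ := fun t ω ↦ N t ω + P1m t ω with hZ1def
  have hZ1 : Martingale Z1 𝓕 Q := hN1.add hP1m
  have hZ10 : Z1 0 = 0 := by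
    funext ω
    simp [hZ1def, hNdef, hP1mdef]
  have hf0m : StronglyMeasurable[𝓕 0] fun ω ↦ f (X 0 ω) :=
    hfC.continuous.comp_stronglyMeasurable (hX.stronglyAdapted 0)
  have hmul : Martingale (fun t ω ↦ f (X 0 ω) * Z1 t ω) 𝓕 Q := hZ1.bdd_mul_of_apply_zero hZ10 hf0m ⟨Cf, fun ω ↦ hCf _⟩
  set Z2 : ℝ≥0 → Ω → ℝ := fun t ω ↦ (N2 t ω + P3m t ω) + P2m t ω - 2 * (f (X 0 ω) * Z1 t ω) with hZ2def
  have hZ2 : Martingale Z2 𝓕 Q := by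
    have h := ((hN2.add hP3m).add hP2m).sub (hmul.smul (2 : ℝ))
    have heq : Z2 = (fun t ω ↦ N2 t ω + P3m t ω) + P2m - (2 : ℝ) • fun t ω ↦ f (X 0 ω) * Z1 t ω := by
      funext t ω; simp only [hZ2def, Pi.add_apply, Pi.sub_apply, Pi.smul_apply, smul_eq_mul]
    rw [heq]; exact h
  /- ### pathwise identification
    For each `ω`, all processes at time `t` are smooth path functionals at `r = t ∧ T`. -/
  have key : ∀ (ω : Ω) (t : ℝ≥0),
      let Xp : ℝ → ℝ := fun u ↦ X u.toNNReal ω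
      let φ : ℝ → ℝ := fun u ↦ f (Xp u)
      let ℓ : ℝ → ℝ := fun u ↦ angleGenerator κ ((κ : ℝ) - 6) f (Xp u)
      let d : ℝ → ℝ := fun u ↦ deriv f (Xp u)
      let qp : ℝ → ℝ := fun u ↦ qfc a (Xp u)
      let pp : ℝ → ℝ := fun u ↦ pfc a (Xp u)
      let yp : ℝ → ℝ := fun r ↦ Real.exp (-∫ u in (0 : ℝ)..r, qp u)
      let I : ℝ → ℝ := fun r ↦ ∫ u in (0 : ℝ)..r, ℓ u
      let I2 : ℝ → ℝ := fun r ↦ ∫ u in (0 : ℝ)..r, (2 * φ u * ℓ u + κ * d u ^ 2)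
      let R : ℝ → ℝ := fun r ↦ ∫ u in (0 : ℝ)..r, yp u * pp u
      let r : ℝ := ((min t T : ℝ≥0) : ℝ)
      Yp t ω = yp r ∧ Rp t ω = R r ∧
      clockProc a T X t ω = ∫ u in (0 : ℝ)..r, yp u ^ 2 * qp u ^ 2 ∧
      Z1 t ω = yp r * (φ r - φ 0 - I r) + ∫ u in (0 : ℝ)..r, (φ u - φ 0 - I u) * qp u * yp u ∧
      Z2 t ω = (yp r ^ 2 * (φ r ^ 2 - φ 0 ^ 2 - I2 r) +
          ∫ u in (0 : ℝ)..r, (φ u ^ 2 - φ 0 ^ 2 - I2 u) * (2 * qp u * yp u ^ 2)) +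
        (2 * R r * yp r * (φ r - φ 0 - I r) -
          ∫ u in (0 : ℝ)..r, (φ u - φ 0 - I u) * (2 * (yp u ^ 2 * pp u - R u * qp u * yp u))) -
        2 * φ 0 * (yp r * (φ r - φ 0 - I r) + ∫ u in (0 : ℝ)..r, (φ u - φ 0 - I u) * qp u * yp u) := by
    intro ω t Xp φ ℓ d qp pp yp I I2 R r
    have hXpc : Continuous Xp := (hXc ω).comp continuous_real_toNNReal
    have cφ : Continuous φ := hfC.continuous.comp hXpc
    have cℓ : Continuous ℓ := hLc.comp hXpc
    have cd : Continuous d := hdc.comp hXpc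
    have cq : Continuous qp := hqc.comp hXpc
    have cp : Continuous pp := hpc.comp hXpc
    have hypd : ∀ u, HasDerivAt yp (-(qp u * yp u)) u := fun u ↦ by
      have h := (hasDerivAt_primitive cq u).neg.exp
      refine h.congr_deriv ?_
      simp only [Pi.neg_apply, yp]
      ring
    have cy : Continuous yp := continuous_iff_continuousAt.2 fun u ↦ (hypd u).continuousAt
    have hyp0 : yp 0 = 1 := by simp [yp]
    have cℓ2 : Continuous fun u ↦ 2 * φ u * ℓ u + κ * d u ^ 2 :=
      ((continuous_const.mul cφ).mul cℓ).add (continuous_const.mul (cd.pow 2))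
    have hId : ∀ u, HasDerivAt I (ℓ u) u := hasDerivAt_primitive cℓ
    have cI : Continuous I := continuous_iff_continuousAt.2 fun u ↦ (hId u).continuousAt
    have hI2d : ∀ u, HasDerivAt I2 (2 * φ u * ℓ u + κ * d u ^ 2) u := hasDerivAt_primitive cℓ2
    have cI2 : Continuous I2 := continuous_iff_continuousAt.2 fun u ↦ (hI2d u).continuousAt
    have hRd : ∀ u, HasDerivAt R (yp u * pp u) u := hasDerivAt_primitive (cy.mul cp)
    have cR : Continuous R := continuous_iff_continuousAt.2 fun u ↦ (hRd u).continuousAt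
    have hr0 : 0 ≤ r := (min t T).coe_nonneg
    have hrT : r ≤ T := by exact_mod_cast min_le_right t T
    -- (a) `Yp` at real times `≤ T`, and at `t`
    have hq_read : ∀ u : ℝ, 0 ≤ u → u ≤ T → (fun s ω ↦ qfc a (X s ω)) u.toNNReal ω = qp u := fun u _ _ ↦ rfl
    have hY_real : ∀ u : ℝ, 0 ≤ u → u ≤ T → Yp u.toNNReal ω = yp u := by
      intro u hu0 huT
      simp only [hYpdef, yProc, yp]
      rw [show qKill a T X = fun s ω ↦ if s ≤ T then (fun s ω ↦ qfc a (X s ω)) s ω else 0 from rfl,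
        timeIntegral_killed_eq_of_le hq_read hu0 huT]
    have hY_t : Yp t ω = yp r := by
      simp only [hYpdef, yProc, yp]
      rw [show qKill a T X = fun s ω ↦ if s ≤ T then (fun s ω ↦ qfc a (X s ω)) s ω else 0 from rfl,
        timeIntegral_killed_eq hq_read]
    -- (b) `Rp`
    have hp_read : ∀ u : ℝ, 0 ≤ u → u ≤ T →
        (fun s ω ↦ yProc a T X s ω * pfc a (X s ω)) u.toNNReal ω = yp u * pp u := by
      intro u hu0 huT
      show yProc a T X u.toNNReal ω * pfc a (X u.toNNReal ω) = yp u * pp u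
      rw [← hYpdef, hY_real u hu0 huT]
    have hR_real : ∀ u : ℝ, 0 ≤ u → u ≤ T → Rp u.toNNReal ω = R u := by
      intro u hu0 huT
      simp only [hRpdef, rProc]
      exact timeIntegral_killed_eq_of_le hp_read hu0 huT
    have hR_t : Rp t ω = R r := timeIntegral_killed_eq hp_read t
    -- (c) clock
    have hc_read : ∀ u : ℝ, 0 ≤ u → u ≤ T →
        (fun s ω ↦ yProc a T X s ω ^ 2 * qfc a (X s ω) ^ 2) u.toNNReal ω = yp u ^ 2 * qp u ^ 2 := by
      intro u hu0 huT
      show yProc a T X u.toNNReal ω ^ 2 * qfc a (X u.toNNReal ω) ^ 2 = yp u ^ 2 * qp u ^ 2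
      rw [← hYpdef, hY_real u hu0 huT]
    have hclock_t : clockProc a T X t ω = ∫ u in (0 : ℝ)..r, yp u ^ 2 * qp u ^ 2 := timeIntegral_killed_eq hc_read t
    -- (d) `N`, `N2` at real times `≤ T` and at `t`
    have hL_read : ∀ u : ℝ, 0 ≤ u → u ≤ T →
        (fun s ω ↦ angleGenerator κ ((κ : ℝ) - 6) f (X s ω)) u.toNNReal ω = ℓ u := fun u _ _ ↦ rfl
    have hL2_read : ∀ u : ℝ, 0 ≤ u → u ≤ T →
        (fun s ω ↦ angleGenerator κ ((κ : ℝ) - 6) f2 (X s ω)) u.toNNReal ω = 2 * φ u * ℓ u + κ * d u ^ 2 := by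
      intro u _ _
      show angleGenerator κ ((κ : ℝ) - 6) f2 (X u.toNNReal ω) = 2 * φ u * ℓ u + κ * d u ^ 2
      rw [hf2def, angleGenerator_sq κ _ hfC]
    have hN_real : ∀ u : ℝ, 0 ≤ u → u ≤ T → N u.toNNReal ω = φ u - φ 0 - I u := by
      intro u hu0 huT
      have hmin : min u.toNNReal T = u.toNNReal := min_eq_left (Real.toNNReal_le_iff_le_coe.2 huT)
      simp only [hNdef, hmin]
      rw [timeIntegral_toNNReal_eq hL_read hu0 huT]
      simp [φ, Xp, I, Real.toNNReal_zero]
    have hrr : r.toNNReal = min t T := Real.toNNReal_coe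
    have hN_t : N t ω = φ r - φ 0 - I r := by
      have h := hN_real r hr0 hrT
      have hNmin : N (min t T) ω = N t ω := by simp only [hNdef, min_assoc, min_self]
      rwa [hrr, hNmin] at h
    have hN2_real : ∀ u : ℝ, 0 ≤ u → u ≤ T → N2 u.toNNReal ω = φ u ^ 2 - φ 0 ^ 2 - I2 u := by
      intro u hu0 huT
      have hmin : min u.toNNReal T = u.toNNReal := min_eq_left (Real.toNNReal_le_iff_le_coe.2 huT)
      simp only [hN2def, hmin]
      rw [timeIntegral_toNNReal_eq hL2_read hu0 huT]
      simp [φ, Xp, I2, hf2def, Real.toNNReal_zero]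
    have hN2_t : N2 t ω = φ r ^ 2 - φ 0 ^ 2 - I2 r := by
      have h := hN2_real r hr0 hrT
      have hN2min : N2 (min t T) ω = N2 t ω := by simp only [hN2def, min_assoc, min_self]
      rwa [hrr, hN2min] at h
    -- (e) the killed derivatives and their time integrals
    have hh₁_read : ∀ u : ℝ, 0 ≤ u → u ≤ T →
        (fun s ω ↦ -(qfc a (X s ω) * Yp s ω)) u.toNNReal ω = -(qp u * yp u) := by
      intro u hu0 huT
      show -(qfc a (X u.toNNReal ω) * Yp u.toNNReal ω) = -(qp u * yp u)
      rw [hY_real u hu0 huT]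
    have hI₁ : timeIntegral h₁ t ω = yp r - 1 := by
      rw [show h₁ = fun s ω ↦ if s ≤ T then (fun s ω ↦ -(qfc a (X s ω) * Yp s ω)) s ω else 0 from rfl,
        timeIntegral_killed_eq hh₁_read t,
        intervalIntegral.integral_eq_sub_of_hasDerivAt (fun u _ ↦ hypd u) ((cq.mul cy).neg.intervalIntegrable _ _),
        hyp0]
    have ha2_read : ∀ u : ℝ, 0 ≤ u → u ≤ T →
        (fun s ω ↦ 2 * (Yp s ω ^ 2 * pfc a (X s ω) - Rp s ω * qfc a (X s ω) * Yp s ω)) u.toNNReal ω =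
          2 * (yp u ^ 2 * pp u - R u * qp u * yp u) := by
      intro u hu0 huT
      show 2 * (Yp u.toNNReal ω ^ 2 * pfc a (X u.toNNReal ω) - Rp u.toNNReal ω * qfc a (X u.toNNReal ω) *
        Yp u.toNNReal ω) = 2 * (yp u ^ 2 * pp u - R u * qp u * yp u)
      rw [hY_real u hu0 huT, hR_real u hu0 huT]
    have hA2d : ∀ u, HasDerivAt (fun r ↦ 2 * R r * yp r) (2 * (yp u ^ 2 * pp u - R u * qp u * yp u)) u := by
      intro u
      have h := ((hRd u).const_mul 2).mul (hypd u)
      refine h.congr_deriv ?_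
      ring
    have hI₂ : timeIntegral a2 t ω = 2 * R r * yp r := by
      rw [show a2 = fun s ω ↦ if s ≤ T then
          (fun s ω ↦ 2 * (Yp s ω ^ 2 * pfc a (X s ω) - Rp s ω * qfc a (X s ω) * Yp s ω)) s ω else 0 from rfl,
        timeIntegral_killed_eq ha2_read t,
        intervalIntegral.integral_eq_sub_of_hasDerivAt (fun u _ ↦ hA2d u)
          ((continuous_const.mul (((cy.pow 2).mul cp).sub ((cR.mul cq).mul cy))).intervalIntegrable _ _)]
      have hR0 : R 0 = 0 := intervalIntegral.integral_same
      simp only [hR0, mul_zero, zero_mul, sub_zero]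
      rfl
    have hh₃_read : ∀ u : ℝ, 0 ≤ u → u ≤ T →
        (fun s ω ↦ -(2 * qfc a (X s ω) * Yp s ω ^ 2)) u.toNNReal ω = -(2 * qp u * yp u ^ 2) := by
      intro u hu0 huT
      show -(2 * qfc a (X u.toNNReal ω) * Yp u.toNNReal ω ^ 2) = -(2 * qp u * yp u ^ 2)
      rw [hY_real u hu0 huT]
    have hy2d : ∀ u, HasDerivAt (fun r ↦ yp r ^ 2) (-(2 * qp u * yp u ^ 2)) u := by
      intro u
      have h := (hypd u).pow 2
      refine h.congr_deriv ?_
      simp only [Nat.cast_ofNat, Nat.add_one_sub_one, pow_one]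
      ring
    have hI₃ : timeIntegral h₃ t ω = yp r ^ 2 - 1 := by
      rw [show h₃ = fun s ω ↦ if s ≤ T then (fun s ω ↦ -(2 * qfc a (X s ω) * Yp s ω ^ 2)) s ω else 0 from rfl,
        timeIntegral_killed_eq hh₃_read t,
        intervalIntegral.integral_eq_sub_of_hasDerivAt (fun u _ ↦ hy2d u)
          (((continuous_const.mul cq).mul (cy.pow 2)).neg.intervalIntegrable _ _), hyp0]
      ring
    -- (f) the paired time integrals
    have hNh₁ : timeIntegral (fun s ω ↦ N s ω * h₁ s ω) t ω =
        ∫ u in (0 : ℝ)..r, (φ u - φ 0 - I u) * -(qp u * yp u) := by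
      have hk : (fun s ω ↦ N s ω * h₁ s ω) = fun s ω ↦
          if s ≤ T then (fun s ω ↦ N s ω * -(qfc a (X s ω) * Yp s ω)) s ω else 0 := by
        funext s ω; simp only [hh₁def, mul_ite, mul_zero]
      rw [hk, timeIntegral_killed_eq (fun u hu0 huT ↦ by
        show N u.toNNReal ω * -(qfc a (X u.toNNReal ω) * Yp u.toNNReal ω) = (φ u - φ 0 - I u) * -(qp u * yp u)
        rw [hN_real u hu0 huT, hY_real u hu0 huT])]
    have hNa2 : timeIntegral (fun s ω ↦ N s ω * a2 s ω) t ω =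
        ∫ u in (0 : ℝ)..r, (φ u - φ 0 - I u) * (2 * (yp u ^ 2 * pp u - R u * qp u * yp u)) := by
      have hk : (fun s ω ↦ N s ω * a2 s ω) = fun s ω ↦
          if s ≤ T then (fun s ω ↦ N s ω *
            (2 * (Yp s ω ^ 2 * pfc a (X s ω) - Rp s ω * qfc a (X s ω) * Yp s ω))) s ω else 0 := by
        funext s ω; simp only [ha2def, mul_ite, mul_zero]
      rw [hk, timeIntegral_killed_eq (fun u hu0 huT ↦ by
        show N u.toNNReal ω * (2 * (Yp u.toNNReal ω ^ 2 * pfc a (X u.toNNReal ω) -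
          Rp u.toNNReal ω * qfc a (X u.toNNReal ω) * Yp u.toNNReal ω)) =
          (φ u - φ 0 - I u) * (2 * (yp u ^ 2 * pp u - R u * qp u * yp u))
        rw [hN_real u hu0 huT, hY_real u hu0 huT, hR_real u hu0 huT])]
    have hN2h₃ : timeIntegral (fun s ω ↦ N2 s ω * h₃ s ω) t ω =
        ∫ u in (0 : ℝ)..r, (φ u ^ 2 - φ 0 ^ 2 - I2 u) * -(2 * qp u * yp u ^ 2) := by
      have hk : (fun s ω ↦ N2 s ω * h₃ s ω) = fun s ω ↦
          if s ≤ T then (fun s ω ↦ N2 s ω * -(2 * qfc a (X s ω) * Yp s ω ^ 2)) s ω else 0 := by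
        funext s ω; simp only [hh₃def, mul_ite, mul_zero]
      rw [hk, timeIntegral_killed_eq (fun u hu0 huT ↦ by
        show N2 u.toNNReal ω * -(2 * qfc a (X u.toNNReal ω) * Yp u.toNNReal ω ^ 2) =
          (φ u ^ 2 - φ 0 ^ 2 - I2 u) * -(2 * qp u * yp u ^ 2)
        rw [hN2_real u hu0 huT, hY_real u hu0 huT])]
    have i1 : ∫ u in (0 : ℝ)..r, (φ u - φ 0 - I u) * -(qp u * yp u) =
        -∫ u in (0 : ℝ)..r, (φ u - φ 0 - I u) * qp u * yp u := by
      rw [← intervalIntegral.integral_neg]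
      refine intervalIntegral.integral_congr fun u _ ↦ ?_
      ring
    have i3 : ∫ u in (0 : ℝ)..r, (φ u ^ 2 - φ 0 ^ 2 - I2 u) * -(2 * qp u * yp u ^ 2) =
        -∫ u in (0 : ℝ)..r, (φ u ^ 2 - φ 0 ^ 2 - I2 u) * (2 * qp u * yp u ^ 2) := by
      rw [← intervalIntegral.integral_neg]
      refine intervalIntegral.integral_congr fun u _ ↦ ?_
      ring
    -- assemble
    have hZ1_t : Z1 t ω = yp r * (φ r - φ 0 - I r) + ∫ u in (0 : ℝ)..r, (φ u - φ 0 - I u) * qp u * yp u := by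
      simp only [hZ1def, hP1mdef]
      rw [hN_t, hI₁, hNh₁, i1]
      ring
    refine ⟨hY_t, hR_t, hclock_t, hZ1_t, ?_⟩
    simp only [hZ2def, hP2mdef, hP3mdef]
    rw [hZ1_t, hN_t, hN2_t, hI₂, hI₃, hNa2, hN2h₃, i3]
    have : f (X 0 ω) = φ 0 := by simp [φ, Xp, Real.toNNReal_zero]
    rw [this]
    ring
  /- ### identification with `W` before the band exit -/
  set τ := bandExit ε X with hτdef
  have hτst : IsStoppingTime 𝓕 τ :=
    Process.isStoppingTime_exitTime (fun t ↦ (hX.stronglyAdapted t).measurable) hXc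
  have hτ : IsOptionalTime 𝓕 τ := hτst.isOptionalTime
  have key2 : ∀ (ω : Ω) (w : ℝ≥0), ((w : ℝ≥0) : WithTop ℝ≥0) ≤ τ ω →
      Z1 w ω = wProc a T X w ω - wProc a T X 0 ω ∧
      Z2 w ω = (wProc a T X w ω - wProc a T X 0 ω) ^ 2 - κ * clockProc a T X w ω := by
    intro ω w hw
    by_cases h0 : X 0 ω ∈ Ioo (2 * ε) (2 * π - 2 * ε)
    · obtain ⟨hY_t, hR_t, hclock_t, hZ1_t, hZ2_t⟩ := key ω w
      -- path functions (as in `key`)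
      set Xp : ℝ → ℝ := fun u ↦ X u.toNNReal ω with hXp
      set φ : ℝ → ℝ := fun u ↦ f (Xp u) with hφ
      set ℓ : ℝ → ℝ := fun u ↦ angleGenerator κ ((κ : ℝ) - 6) f (Xp u) with hℓ
      set d : ℝ → ℝ := fun u ↦ deriv f (Xp u) with hd
      set qp : ℝ → ℝ := fun u ↦ qfc a (Xp u) with hqp
      set pp : ℝ → ℝ := fun u ↦ pfc a (Xp u) with hpp
      set yp : ℝ → ℝ := fun r ↦ Real.exp (-∫ u in (0 : ℝ)..r, qp u) with hyp
      set r : ℝ := ((min w T : ℝ≥0) : ℝ) with hr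
      have hXpc : Continuous Xp := (hXc ω).comp continuous_real_toNNReal
      have cφ : Continuous φ := hfC.continuous.comp hXpc
      have cℓ : Continuous ℓ := hLc.comp hXpc
      have cd : Continuous d := hdc.comp hXpc
      have cq : Continuous qp := hqc.comp hXpc
      have cp : Continuous pp := hpc.comp hXpc
      have hypd : ∀ u, HasDerivAt yp (-(qp u * yp u)) u := fun u ↦ by
        have h := (hasDerivAt_primitive cq u).neg.exp
        refine h.congr_deriv ?_
        simp only [Pi.neg_apply, hyp]
        ring
      have cy : Continuous yp := continuous_iff_continuousAt.2 fun u ↦ (hypd u).continuousAt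
      have hyp0 : yp 0 = 1 := by simp [hyp]
      have hr0 : 0 ≤ r := (min w T).coe_nonneg
      -- the band facts on `[0, r]`
      have hin : ∀ u ∈ Icc (0 : ℝ) r, Xp u ∈ ball (π : ℝ) b.rIn := by
        intro u hu
        have hu2 : u.toNNReal ≤ min w T := Real.toNNReal_le_iff_le_coe.2 hu.2
        have hu' : ((u.toNNReal : ℝ≥0) : WithTop ℝ≥0) ≤ τ ω :=
          ((WithTop.coe_le_coe.2 (hu2.trans (min_le_left w T))).trans hw)
        have hmem : X u.toNNReal ω ∈ Icc (2 * ε) (2 * π - 2 * ε) := by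
          have h := Process.stoppedProcess_exitTime_mem_Icc (u := X) (hXc ω) h0 u.toNNReal
          rwa [Process.stoppedProcess_exitTime_eq_of_le hu'] at h
        refine hball ?_
        show |X u.toNNReal ω - π| ≤ π - 2 * ε
        rw [abs_le]
        constructor <;> linarith [hmem.1, hmem.2]
      have hφc : ∀ u ∈ Icc (0 : ℝ) r, φ u = cotc a (Xp u) := fun u hu ↦ by
        rw [hφ, hfdef]
        show testFn b (Xp u) = cotc a (Xp u)
        rw [testFn_apply (hin u hu), cotc_of_mem (hXband _ _)]
      have hdrift : ∀ u ∈ Icc (0 : ℝ) r, pp u - qp u * φ u + ℓ u = 0 := fun u hu ↦ by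
        simp only [hpp, hqp, hφ, hℓ, hfdef]
        rw [pfc_of_mem (hXband _ _), qfc_of_mem (hXband _ _)]
        exact drift_eq_zero κ hbInπ (hin u hu)
      have hd2 : ∀ u ∈ Icc (0 : ℝ) r, d u ^ 2 = qp u ^ 2 := fun u hu ↦ by
        simp only [hd, hqp, hfdef]
        rw [deriv_testFn_sq hbInπ (hin u hu), qfc_of_mem (hXband _ _)]
      -- vanishing of the drift integrals
      have hD1 : ∫ u in (0 : ℝ)..r, yp u * (pp u - qp u * φ u + ℓ u) = 0 := by
        rw [intervalIntegral.integral_congr (g := fun _ ↦ (0 : ℝ)) fun u hu ↦ by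
          rw [uIcc_of_le hr0] at hu
          show yp u * (pp u - qp u * φ u + ℓ u) = 0
          rw [hdrift u hu, mul_zero]]
        simp
      have hD2 : ∫ u in (0 : ℝ)..r, 2 * yp u * (yp u * φ u + (∫ v in (0 : ℝ)..u, yp v * pp v)) *
          (pp u - qp u * φ u + ℓ u) = 0 := by
        rw [intervalIntegral.integral_congr (g := fun _ ↦ (0 : ℝ)) fun u hu ↦ by
          rw [uIcc_of_le hr0] at hu
          show 2 * yp u * (yp u * φ u + (∫ v in (0 : ℝ)..u, yp v * pp v)) * (pp u - qp u * φ u + ℓ u) = 0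
          rw [hdrift u hu, mul_zero]]
        simp
      have hclockd : ∫ u in (0 : ℝ)..r, yp u ^ 2 * d u ^ 2 = ∫ u in (0 : ℝ)..r, yp u ^ 2 * qp u ^ 2 :=
        intervalIntegral.integral_congr fun u hu ↦ by
          rw [uIcc_of_le hr0] at hu
          show yp u ^ 2 * d u ^ 2 = yp u ^ 2 * qp u ^ 2
          rw [hd2 u hu]
      -- `W_w - W_0 = R_r + 𝒴_r φ_r - φ_0`
      have hW : wProc a T X w ω - wProc a T X 0 ω = (∫ u in (0 : ℝ)..r, yp u * pp u) + yp r * φ r - φ 0 := by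
        have hr_mem : r ∈ Icc (0 : ℝ) r := ⟨hr0, le_rfl⟩
        have h0_mem : (0 : ℝ) ∈ Icc (0 : ℝ) r := ⟨le_rfl, hr0⟩
        have e1 : cotc a (X (min w T) ω) = φ r := by
          rw [hφc r hr_mem]
          simp only [hXp, hr, Real.toNNReal_coe]
        have e2 : cotc a (X (min 0 T) ω) = φ 0 := by
          rw [hφc 0 h0_mem]
          simp only [hXp, Real.toNNReal_zero, min_eq_left (show (0 : ℝ≥0) ≤ T from bot_le)]
        have e3 : yProc a T X 0 ω = 1 := by simp [yProc]
        have e4 : rProc a T X 0 ω = 0 := by simp [rProc]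
        simp only [wProc]
        rw [e1, e2, e3, e4, ← hYpdef, ← hRpdef, hY_t, hR_t]
        ring
      constructor
      · rw [hZ1_t, hW]
        have h := identity_one cφ cℓ cq cp cy hypd hyp0 r
        rw [hD1, add_zero] at h
        linarith
      · rw [hZ2_t, hW, hclock_t, ← hclockd]
        have h := identity_two cφ cℓ cq cp cd cy hypd hyp0 κ r
        simp only at h
        rw [hD1, hD2, mul_zero, sub_zero, add_zero] at h
        linarith
    · -- the path starts outside `[2ε, 2π - 2ε]`: `τ = 0`, `w = 0`
      have hτ0 : τ ω = 0 := by
        refine le_antisymm ?_ bot_le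
        change Process.exitTime X (2 * ε) (2 * π - 2 * ε) ω ≤ ((0 : ℝ≥0) : WithTop ℝ≥0)
        exact (Process.exitTime_le_coe_iff (hXc ω)).2 ⟨0, le_rfl, h0⟩
      have hw0 : w = 0 := by
        rw [hτ0] at hw
        exact le_antisymm (by exact_mod_cast hw) bot_le
      subst hw0
      have hZ20 : Z2 0 ω = 0 := by
        have h1 : Z1 0 ω = 0 := by rw [hZ10]; rfl
        simp [hZ2def, hN2def, hP3mdef, hP2mdef, h1]
      refine ⟨by rw [hZ10]; simp, ?_⟩
      rw [hZ20]
      simp [clockProc]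
  /- ### continuity of the paths of `Z1`, `Z2` -/
  have hcont : ∀ ω, Continuous (fun t ↦ Z1 t ω) ∧ Continuous (fun t ↦ Z2 t ω) := by
    intro ω
    set Xp : ℝ → ℝ := fun u ↦ X u.toNNReal ω with hXp
    set φ : ℝ → ℝ := fun u ↦ f (Xp u) with hφ
    set ℓ : ℝ → ℝ := fun u ↦ angleGenerator κ ((κ : ℝ) - 6) f (Xp u) with hℓ
    set d : ℝ → ℝ := fun u ↦ deriv f (Xp u) with hd
    set qp : ℝ → ℝ := fun u ↦ qfc a (Xp u) with hqp
    set pp : ℝ → ℝ := fun u ↦ pfc a (Xp u) with hpp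
    set yp : ℝ → ℝ := fun r ↦ Real.exp (-∫ u in (0 : ℝ)..r, qp u) with hyp
    set I : ℝ → ℝ := fun r ↦ ∫ u in (0 : ℝ)..r, ℓ u with hI
    set I2 : ℝ → ℝ := fun r ↦ ∫ u in (0 : ℝ)..r, (2 * φ u * ℓ u + κ * d u ^ 2) with hI2
    set R : ℝ → ℝ := fun r ↦ ∫ u in (0 : ℝ)..r, yp u * pp u with hR
    have hXpc : Continuous Xp := (hXc ω).comp continuous_real_toNNReal
    have cφ : Continuous φ := hfC.continuous.comp hXpc
    have cℓ : Continuous ℓ := hLc.comp hXpc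
    have cd : Continuous d := hdc.comp hXpc
    have cq : Continuous qp := hqc.comp hXpc
    have cp : Continuous pp := hpc.comp hXpc
    have cy : Continuous yp := Real.continuous_exp.comp (continuous_primitive' cq).neg
    have cI : Continuous I := continuous_primitive' cℓ
    have cI2 : Continuous I2 := continuous_primitive' (((continuous_const.mul cφ).mul cℓ).add (continuous_const.mul (cd.pow 2)))
    have cR : Continuous R := continuous_primitive' (cy.mul cp)
    have cN : Continuous fun u ↦ φ u - φ 0 - I u := (cφ.sub continuous_const).sub cI
    have cN2 : Continuous fun u ↦ φ u ^ 2 - φ 0 ^ 2 - I2 u := ((cφ.pow 2).sub continuous_const).sub cI2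
    set Φ₁ : ℝ → ℝ := fun r ↦ yp r * (φ r - φ 0 - I r) + ∫ u in (0 : ℝ)..r, (φ u - φ 0 - I u) * qp u * yp u with hΦ₁
    set Φ₂ : ℝ → ℝ := fun r ↦ (yp r ^ 2 * (φ r ^ 2 - φ 0 ^ 2 - I2 r) +
          ∫ u in (0 : ℝ)..r, (φ u ^ 2 - φ 0 ^ 2 - I2 u) * (2 * qp u * yp u ^ 2)) +
        (2 * R r * yp r * (φ r - φ 0 - I r) -
          ∫ u in (0 : ℝ)..r, (φ u - φ 0 - I u) * (2 * (yp u ^ 2 * pp u - R u * qp u * yp u))) -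
        2 * φ 0 * (yp r * (φ r - φ 0 - I r) + ∫ u in (0 : ℝ)..r, (φ u - φ 0 - I u) * qp u * yp u) with hΦ₂
    have cΦ₁ : Continuous Φ₁ :=
      (cy.mul cN).add (continuous_primitive' ((cN.mul cq).mul cy))
    have cΦ₂ : Continuous Φ₂ :=
      ((((cy.pow 2).mul cN2).add (continuous_primitive' (cN2.mul ((continuous_const.mul cq).mul (cy.pow 2))))).add
        ((((continuous_const.mul cR).mul cy).mul cN).sub
          (continuous_primitive' (cN.mul (continuous_const.mul (((cy.pow 2).mul cp).sub ((cR.mul cq).mul cy))))))).sub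
        (continuous_const.mul ((cy.mul cN).add (continuous_primitive' ((cN.mul cq).mul cy))))
    have hmin : Continuous fun t : ℝ≥0 ↦ ((min t T : ℝ≥0) : ℝ) := NNReal.continuous_coe.comp (continuous_id.min continuous_const)
    have e1 : (fun t ↦ Z1 t ω) = fun t ↦ Φ₁ ((min t T : ℝ≥0) : ℝ) := funext fun t ↦ (key ω t).2.2.2.1
    have e2 : (fun t ↦ Z2 t ω) = fun t ↦ Φ₂ ((min t T : ℝ≥0) : ℝ) := funext fun t ↦ (key ω t).2.2.2.2
    exact ⟨e1 ▸ cΦ₁.comp hmin, e2 ▸ cΦ₂.comp hmin⟩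
  /- ### optional stopping and the clock structure -/
  have hY' : IsAEMartingale (stoppedProcess Z1 τ) 𝓕 Q :=
    hZ1.isAEMartingale_stoppedProcess (ae_of_all _ fun ω ↦ (hcont ω).1) hτ
  have hZ' : IsAEMartingale (stoppedProcess Z2 τ) 𝓕 Q :=
    hZ2.isAEMartingale_stoppedProcess (ae_of_all _ fun ω ↦ (hcont ω).2) hτ
  set Y : ℝ≥0 → Ω → ℝ := stoppedProcess (swMart κ a T X) τ with hYdef
  set c : ℝ≥0 → Ω → ℝ := swClock a T ε X with hcdef
  have hid1 : ∀ t ω, stoppedProcess Z1 τ t ω = L * Y t ω := by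
    intro t ω
    simp only [hYdef, stoppedProcess, swMart]
    rw [← hLdef, mul_div_cancel₀ _ hL.ne']
    exact (key2 ω _ (Literature.Probability.Process.coe_untopA_min_le t (τ ω))).1
  have hid2 : ∀ t ω, stoppedProcess Z2 τ t ω = κ * K * (Y t ω ^ 2 - c t ω) := by
    intro t ω
    have h1 := hid1 t ω
    simp only [stoppedProcess] at h1 ⊢
    have h2 := (key2 ω _ (Literature.Probability.Process.coe_untopA_min_le t (τ ω))).2
    rw [h2, ← (key2 ω _ (Literature.Probability.Process.coe_untopA_min_le t (τ ω))).1, h1]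
    simp only [hcdef, swClock, ← hτdef, ← hQ₀def, ← hKdef]
    rw [mul_pow, hL2]
    field_simp
  -- bounds on `W`
  have hWb : ∀ t ω, |wProc a T X t ω| ≤ P₀ * T + C₀ := fun t ω ↦ by
    simp only [wProc]
    rw [← hYpdef, ← hRpdef]
    calc |Rp t ω + Yp t ω * cotc a (X (min t T) ω)| ≤ |Rp t ω| + |Yp t ω * cotc a (X (min t T) ω)| := abs_add_le _ _
      _ ≤ P₀ * T + 1 * C₀ := by
        refine add_le_add (hRb t ω) ?_
        rw [abs_mul]
        exact mul_le_mul (hYabs t ω) (abs_cotc_le ha ha' _) (abs_nonneg _) zero_le_one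
      _ = P₀ * T + C₀ := by ring
  -- the clock as a path integral with rate in `[0, K]`
  have hclock : ∀ ω (w : ℝ≥0), ∃ g : ℝ → ℝ, Continuous g ∧ (∀ u, 0 ≤ u → 0 ≤ g u ∧ g u ≤ K) ∧
      ∀ w' : ℝ≥0, clockProc a T X w' ω = ∫ u in (0 : ℝ)..((min w' T : ℝ≥0) : ℝ), g u := by
    intro ω w
    set Xp : ℝ → ℝ := fun u ↦ X u.toNNReal ω with hXp
    set qp : ℝ → ℝ := fun u ↦ qfc a (Xp u) with hqp
    set yp : ℝ → ℝ := fun r ↦ Real.exp (-∫ u in (0 : ℝ)..r, qp u) with hyp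
    have hXpc : Continuous Xp := (hXc ω).comp continuous_real_toNNReal
    have cq : Continuous qp := hqc.comp hXpc
    have cy : Continuous yp := Real.continuous_exp.comp (continuous_primitive' cq).neg
    refine ⟨fun u ↦ yp u ^ 2 * qp u ^ 2, (cy.pow 2).mul (cq.pow 2), fun u hu ↦ ⟨by positivity, ?_⟩,
      fun w' ↦ (key ω w').2.2.1⟩
    have hy1 : yp u ≤ 1 := by
      simp only [hyp]
      refine Real.exp_le_one_iff.2 (neg_nonpos.2 (intervalIntegral.integral_nonneg hu fun v _ ↦ (qfc_pos ha ha' _).le))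
    have hy0 : 0 ≤ yp u := (Real.exp_pos _).le
    have hq0 : 0 ≤ qp u := (qfc_pos ha ha' _).le
    calc yp u ^ 2 * qp u ^ 2 ≤ 1 ^ 2 * Q₀ ^ 2 :=
          mul_le_mul (pow_le_pow_left₀ hy0 hy1 2) (pow_le_pow_left₀ hq0 (hqle _) 2) (by positivity) (by positivity)
      _ = K := by rw [hKdef]; ring
  exact
    { isAEMartingale := by
        have h := hY'.const_mul L⁻¹
        have heq : (fun t ω ↦ L⁻¹ * stoppedProcess Z1 τ t ω) = Y := by
          funext t ω; rw [hid1 t ω, ← mul_assoc, inv_mul_cancel₀ hL.ne', one_mul]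
        rwa [heq] at h
      isAEMartingale_sq_sub := by
        have h := hZ'.const_mul ((κ : ℝ) * K)⁻¹
        have heq : (fun t ω ↦ ((κ : ℝ) * K)⁻¹ * stoppedProcess Z2 τ t ω) = fun t ω ↦ Y t ω ^ 2 - c t ω := by
          funext t ω; rw [hid2 t ω, ← mul_assoc, inv_mul_cancel₀ hκK.ne', one_mul]
        rwa [heq] at h
      clock_zero := fun ω ↦ by
        simp only [hcdef, swClock, untopA_min_zero, clockProc, timeIntegral_apply_zero, zero_div]
      clock_mono := fun ω s t hst ↦ by
        obtain ⟨g, hgc, hgb, hgeq⟩ := hclock ω 0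
        simp only [hcdef, swClock, ← hτdef, ← hQ₀def, ← hKdef]
        refine div_le_div_of_nonneg_right ?_ hK.le
        rw [hgeq, hgeq]
        have hmono : min ((min (s : WithTop ℝ≥0) (τ ω)).untopA) T ≤ min ((min (t : WithTop ℝ≥0) (τ ω)).untopA) T :=
          min_le_min_right T (untopA_min_mono (τ ω) hst)
        refine intervalIntegral.integral_mono_interval le_rfl (NNReal.coe_nonneg _) (NNReal.coe_le_coe.2 hmono)
          ?_ (hgc.intervalIntegrable _ _)
        filter_upwards [ae_restrict_mem measurableSet_Ioc] with u hu
        exact (hgb u hu.1.le).1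
      clock_sub_le := fun ω s t hst ↦ by
        obtain ⟨g, hgc, hgb, hgeq⟩ := hclock ω 0
        simp only [hcdef, swClock, ← hτdef, ← hQ₀def, ← hKdef]
        set ws := (min (s : WithTop ℝ≥0) (τ ω)).untopA with hws
        set wt := (min (t : WithTop ℝ≥0) (τ ω)).untopA with hwt
        have h1 := untopA_min_sub_le (τ ω) hst
        have h2 := untopA_min_mono (τ ω) hst
        rw [← hws, ← hwt] at h1 h2
        have hmono : ((min ws T : ℝ≥0) : ℝ) ≤ ((min wt T : ℝ≥0) : ℝ) := NNReal.coe_le_coe.2 (min_le_min_right T h2)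
        have hdiff : ((min wt T : ℝ≥0) : ℝ) - ((min ws T : ℝ≥0) : ℝ) ≤ (wt : ℝ) - ws := by
          push_cast
          rcases le_total (wt : ℝ) T with h | h
          · rw [min_eq_left h, min_eq_left ((NNReal.coe_le_coe.2 h2).trans h)]
          · rw [min_eq_right h]
            rcases le_total (ws : ℝ) T with h' | h'
            · rw [min_eq_left h']; linarith
            · rw [min_eq_right h']; have := NNReal.coe_le_coe.2 h2; linarith
        rw [hgeq, hgeq, div_sub_div_same, div_le_iff₀ hK,
          intervalIntegral.integral_interval_sub_left (hgc.intervalIntegrable _ _) (hgc.intervalIntegrable _ _)]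
        have hb := intervalIntegral.norm_integral_le_of_norm_le_const (a := ((min ws T : ℝ≥0) : ℝ))
          (b := ((min wt T : ℝ≥0) : ℝ)) (f := g) (C := K) fun u hu ↦ by
            rw [uIoc_of_le hmono] at hu
            rw [Real.norm_eq_abs, abs_of_nonneg (hgb u ((NNReal.coe_nonneg _).trans hu.1.le)).1]
            exact (hgb u ((NNReal.coe_nonneg _).trans hu.1.le)).2
        rw [Real.norm_eq_abs, abs_of_nonneg (sub_nonneg.2 hmono)] at hb
        calc ∫ u in ((min ws T : ℝ≥0) : ℝ)..((min wt T : ℝ≥0) : ℝ), g u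
            ≤ |∫ u in ((min ws T : ℝ≥0) : ℝ)..((min wt T : ℝ≥0) : ℝ), g u| := le_abs_self _
          _ ≤ K * (((min wt T : ℝ≥0) : ℝ) - ((min ws T : ℝ≥0) : ℝ)) := hb
          _ ≤ ((t : ℝ) - s) * K := by
            rw [mul_comm]
            exact mul_le_mul_of_nonneg_right (hdiff.trans h1) hK.le
      abs_le := ae_of_all _ fun ω t ↦ by
        simp only [hYdef, stoppedProcess, swMart, ← hLdef]
        rw [abs_div, abs_of_pos hL]
        refine div_le_div_of_nonneg_right ?_ hL.le
        calc |wProc a T X _ ω - wProc a T X 0 ω| ≤ |wProc a T X _ ω| + |wProc a T X 0 ω| := abs_sub _ _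
          _ ≤ (P₀ * T + C₀) + (P₀ * T + C₀) := add_le_add (hWb _ ω) (hWb 0 ω)
          _ = 2 * (T * P₀ + C₀) := by ring }

end Main


end SchrammWilson

end Literature.Probability.RandomPlanarGeometry
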